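import Mathlib.NumberTheory.Padics.RingHoms
import Mathlib.NumberTheory.Padics.ProperSpace
import Literature.NumberTheory.EllipticCurves.BSDAverageRankFiveSelmer
import Literature.NumberTheory.EllipticCurves.SelmerLocalRestrictionKernel
import HarnessLib

/-!
# Bhargava–Skinner 2014, Theorem 7 (ii) for the identity class at `ν = p = 5` (with Theorem 7 (i)'s
# identification, Proposition 12's disc and Theorem 9 (a)'s constant): near every `5`-adic point, in
# every large family, the non-identity `5`-Selmer elements with trivial restriction at `5` have the
# share `1 / #E(ℚ₅)/5E(ℚ₅)` — ONE cited-only named fact, and the PROVED road from it to the binder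
# `hlocP` of `bsz_rankLeOne_cRank_of_pieces`

Topic `NumberTheory/EllipticCurves`, story `BhargavaSkinner2014/` (M. Bhargava, C. Skinner, *A positive
proportion of elliptic curves over `ℚ` have rank one*, J. Ramanujan Math. Soc. **29** (2014) 221–242
= arXiv:1401.0233; bib `BhargavaSkinner2014`, PUBLISHED). PRIMARY READ 2026-08-24 on the held text
`paper:arxiv-1401.0233` (corpus-tex, 14 chunks); every locator below is `chunk:line` of that text
(theorem numbers agree with the journal version per the bib note).

HONEST FRAMING (cell `b2b-bsdres`, BSD-DENSITY SPRINT task (b), book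
`cells/density/CONVERSION-QUEUE.md` §2 group (B) row `hlocP` and `K1-LOCATORS.md` row A11 (b); D1 item
"Bhargava–Skinner 2014 Thm 7 (ii) + Lemma 16 AS PRINTED, consumer pub-bsdpct's `hlocP`" served in the
interim by the cell lead, lit GEN 119): the ONE `def … : Prop` below is a SENTENCE typed from a
refereed paper, hypotheses complete, consumed BY NAME as a hypothesis — it proves nothing about
elliptic curves, books nothing and moves no density number, mark, label, count or tier; proposed
sprint sub-label «literal» (the tier word is the referee desks' / the sprint lead's). Net debt `+1`
(D-0026), by-name consumer = the binder `hlocP` of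
`Literature.NumberTheory.EllipticCurves.bsz_rankLeOne_cRank_of_pieces`
(`LeadingTermBSZResCellAssemblyProofs.lean`) through the PROVED theorems of this file (§ Consequences).
No `_holds` is expected: the printed proof (§4 of the source) is the geometry-of-numbers count of
[BS5] on the `40`-dimensional representation `5 ⊗ ∧²5` of `GL₅ × GL₅` (Thm. 9), the orbit/stabiliser
analysis of Prop. 12 and the local analysis of Prop. 11 — none of it is in the tree or in Mathlib.
Everything else in this file is DEFINITIONS WITH BODIES (`resPair`, `discFamily`,
`EquidistributedOnClass`) and THEOREMS.

## The printed statements (verbatim, held text `paper:arxiv-1401.0233`)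

**Theorem 7** (`p0005` L18–L40): "Let `F` be a large family of elliptic curves over `ℚ`, and let
`E = E_{A₀,B₀}` be any elliptic curve in `F`. There exists a `5`-adic neighborhood
`W ⊂ ℤ₅² ∖ {Δ = 0}` of `(A₀,B₀)` such that the large subfamily `F(W)` of `F` containing all the
curves `E_{A,B}` in `F` with `(A,B) ∈ W` has the property that: (i) For each `E′ ∈ F(W)`,
`E′(ℚ₅)/5E′(ℚ₅)` is naturally identified with `E(ℚ₅)/5E(ℚ₅)`, and via this identification the image
of the natural map `E′(ℚ₅)[5] → E′(ℚ₅)/5E′(ℚ₅)` is identified with that of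
`E(ℚ₅)[5] → E(ℚ₅)/5E(ℚ₅)`. (ii) When the elliptic curves `E′ ∈ F(W)` are ordered by height, the images
of the non-identity `5`-Selmer elements under the natural restriction map
`Sel₅(E′) → E′(ℚ₅)/5E′(ℚ₅) = E(ℚ₅)/5E(ℚ₅)` are equidistributed in `E(ℚ₅)/5E(ℚ₅)`."
**How it is proved** (`p0009` L113–L124): "To deduce Theorem 7, we combine Theorem 9 with two
propositions [Props. 11, 12] …". **Theorem 9** (`p0009` L59–L93): "Fix a place `ν` of `ℚ`. Let
`F = F_Σ` be a large family of elliptic curves `E` such that (a) the cardinality of `E(ℚ_ν)/5E(ℚ_ν)`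
is a constant `k` for all `E` in `F`; and (b) the set `U_ν(F) := {soluble elements in V(ℤ_ν) having
invariants (A,B) s.t. (A,B) ∈ Σ_ν}` can be partitioned into `k` open sets `Ω₁,…,Ω_k` such that:
(i) for all `i`, if two elements in `Ω_i` have the same invariants `A, B`, then they are
`G(ℚ_ν)`-equivalent; and (ii) for all `i ≠ j`, `(G(ℚ_ν)·Ω_i) ∩ (G(ℚ_ν)·Ω_j) = ∅`. Then for
`E ∈ F`, the elements of `E(ℚ_ν)/5E(ℚ_ν)` are in bijection with the sets `Ω_i`. (In particular, the
groups `E(ℚ_ν)/5E(ℚ_ν)` are identified for all `E` in `F`.) When the elliptic curves `E` in `F` are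
ordered by height, the images of the nonidentity `5`-Selmer elements under the restriction map
`Sel₅(E) → E(ℚ_ν)/5E(ℚ_ν) ↔ {Ω₁,…,Ω_k}` are equidistributed." (Proof, `p0009` L95–L106: "… This
gives us the average number of nonidentity `5`-Selmer elements that map to `S`, and we see that the
result is proportional to the size of `S`".) **Proposition 12** (`p0010` L103–L109): "Fix a place `ν`
of `ℚ`. For any given `(A,B) ∈ ℤ_ν² ∖ {Δ = 0}`, there exists a `ν`-adic neighborhood `W` of
`(A₀,B₀) = (A,B)` in `ℤ_ν²` such that the corresponding (large) family `F = F(W)`, consisting of all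
elliptic curves `E_{A,B}` with `(A,B) ∈ W`, satisfies both (a) and (b) of Theorem 9." (End of its
proof, `p0011` L45–L57: "`W′ = {(A,B) ∈ ℤ_p² | (A,B) ∈ ∩_i π(Z_i)}` … is an open set in `ℤ_p²`
containing `(A,B)`. Let `W ⊂ W′` be an open neighborhood of `(A,B)` small enough so that for all
elliptic curves `E = E_{A,B}` with `(A,B) ∈ W`, we have `#(E(ℚ_p)/5E(ℚ_p)) = k`. Such a neighborhood `W`
exists because the size of `E(ℚ_p)/5E(ℚ_p)` is locally constant (see Proposition 11). Then `F(W)`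
satisfies both (a) and (b), with `Ω_i = Z_i ∩ π⁻¹({(A,B) ∈ W})`.") **Lemma 16, proof** (`p0012`
L120–L129): "By Theorem 7, the large family `F` can be partitioned into a finite union of large
subfamilies for each of which the groups `E(ℚ_p)/pE(ℚ_p)` as well as the images of `E(ℚ_p)[p]` have
been identified. Furthermore, as each `E ∈ F` has good, ordinary reduction at `p`, we have that
`#E(ℚ_p)/pE(ℚ_p) = p·#E(ℚ_p)[p]` is equal to `p` or `p²`. By Theorem 5 [= [BS5] Thm. 31: average
`#Sel₅ = 6` in large families], Lemma 15, and the equidistribution result of Theorem 7 for the curves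
in each of these subfamilies, the number of non-trivial Selmer elements in `Sel_p(E)` for some
`E ∈ F` with `H(E) < X` that restrict to an element in the image of `E(ℚ_p)[p]` is
`(#E(ℚ_p)[p] / #E(ℚ_p)/pE(ℚ_p))·p·N(X) + o(X^{5/6}) = N(X) + ε̃₁(X)`." **Height and families**
(`p0002` L6–L11; `p0008` L13–L43): `H(E_{A,B}) = max{4|A³|, 27B²}` on the model with `ℓ⁶ ∤ B`
whenever `ℓ⁴ ∣ A` (= the tree's `naiveHeight` / `IsInHeightFamily`); "`F_Σ` … defined by congruence
conditions" = closed `Σ_ℓ ⊂ ℤ_ℓ²` with boundary of measure `0` at every prime `ℓ` (+ a sign condition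
at `∞`); "large" = "for all sufficiently large primes `ℓ`, the set `Inv_ℓ(F)` contains all pairs
`(A,B) ∈ ℤ_ℓ²` such that `ℓ² ∤ Δ(A,B)`" (= the tree's `CongruenceFamily.IsLarge`, which transcribes it
as density of members in every such residue class).

## What is vendored, and in which currency (verbatim ↔ Lean, one line per clause)

ONE cited-only named fact, `thm7_selmerResKer_equidistributed` = **Thm. 7 (ii) for the identity class,
at the place `ν = p = 5` of the source ("We set `ν = p = 5`", `p0011` L60), with Thm. 7 (i)'s
identification of the groups `E(ℚ₅)/5E(ℚ₅)` across the neighbourhood and the disc / constant delivered by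
Prop. 12 / Thm. 9 (a)** (Thm. 7 = Thm. 9 + Props. 11–12, `p0009` L113–L124; referee A R211.5 n152: at
`ν = 5` the identity-class clause is Thm. 7 (i)+(ii) AS STATED, whereas at a finite place `ν = ℓ ≠ 5` it
would be a READING of Thm. 9 + Props. 11–12 — not printed as a theorem, hence NOT transcribed), in the
vocabulary of `BSDRankZeroDensity.lean` (`CongruenceFamily`, `IsLarge`, `heightFamilyBelow`),
`HeightFamily.lean` (`shortWeierstrass`), `KummerSelmerStructure.lean` / `LocalKummerMap.lean`
(`kummerLocalConditionAt n K_v` = the image `𝓛_v ≅ E(K_v)/nE(K_v)` of the local Kummer map, so that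
`#E(ℚ_ν)/5E(ℚ_ν) = Nat.card (kummerLocalConditionAt 5 ℚ_v)`), and `SelmerLocalRestrictionKernel.lean`
(`selmerResKer 5 ℚ_v` = the `5`-Selmer classes with trivial restriction at `v`, Bhargava–Skinner's `Z`,
referee A R202.4 (c)):
* "Fix a place `ν` of `ℚ`" (Thm. 9 / Prop. 12) with "We set `ν = p = 5`" (proof of Thm. 7, `p0011`
  L60) = the prime `5` (`[Fact (Nat.Prime 5)]`) and the place `v : HeightOneSpectrum (𝓞 ℚ)` with `5 ∈ v`
  (`ℚ_v = v.adicCompletion ℚ ≅ ℚ₅`); the places `ν = ∞` and `ν = ℓ ≠ 5` are NOT transcribed (a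
  restriction; the auxiliary topology / congruence-family lemmas below are nevertheless written for any
  prime `ℓ`, since they cite no theorem of the source beyond Prop. 12's disc shape).
* "For any given `(A,B) ∈ ℤ_ν² ∖ {Δ = 0}`" (Prop. 12) = `x : ℤ_[5] × ℤ_[5]` with
  `4x₁³ + 27x₂² ≠ 0` (`Δ = -(4A³ + 27B²)`).
* "there exists a `ν`-adic neighborhood `W` of `(A,B)`" = `∃ k`, `W := x + 5^k ℤ₅²`, the disc of the
  points with the same residue pair modulo `5 ^ k` (`resPair k`, Mathlib's `PadicInt.toZModPow`). This
  is EQUIVALENT to the printed `∃ W` here, not stronger: every neighbourhood contains such a disc, and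
  the property asserted of `W` below is inherited by smaller neighbourhoods (it quantifies over the
  families supported INSIDE `W`).
* "the (large) family `F(W)` … satisfies (a) and (b)" + Thm. 9 "Let `F = F_Σ` be a large family …
  such that (a) … (b) … Then …" = `∀ G : CongruenceFamily`, `G.IsLarge`, all of whose members lie in
  `W` (`resPair k (A, B) = resPair k x`): the ONE inference used is that (a) and (b) for `F(W)` pass to
  every family `G` defined by congruence conditions with `Σ_ν(G) ⊆ W` — (a) restricts, and (b)
  restricts with `Ω_i ∩ π⁻¹(Σ_ν(G))`, exactly the last sentence of the proof of Prop. 12 quoted above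
  ("`Ω_i = Z_i ∩ π⁻¹({(A,B) ∈ W})`" for the shrunken `W ⊂ W′`); conditions of `G` at primes other than
  `ν` do not enter `U_ν`. So Thm. 9 applies to every large `G` with `Σ_ν(G) ⊆ W`; and a family `G`
  all of whose MEMBERS lie in `W` (the hypothesis as typed, `_hW`) has the same members — hence the same
  counts, the same constant in (a), and the same largeness (largeness is member-based in the source:
  `Inv_ℓ(F)` is the closure of `Inv(F) = {(A,B) : E_{A,B} ∈ F}`, `p0008` L28–L36, as is the tree's
  `IsLarge`) — as the family `G ∩ F(W)` obtained by adding the condition "`≡ x (mod ℓ^k)`" at `ν`, to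
  which the previous sentence applies.
* (a) "the cardinality of `E(ℚ_ν)/5E(ℚ_ν)` is a constant `k` for all `E`" = `∃ m`, `∀ AB ∈ G`,
  `Nat.card (kummerLocalConditionAt 5 ℚ_v (E_{A,B})) = m` (the printed `k`; our `k` is the level).
* "the images of the nonidentity `5`-Selmer elements under `Sel₅(E) → E(ℚ_ν)/5E(ℚ_ν)` are
  equidistributed [among the `k` classes]" is typed ONLY FOR THE IDENTITY CLASS (a WEAKENING: one
  class of `k`), and in the robust count form: with `N₀(X) = Σ_{E ∈ G, H(E) < X} (#Z_v(E) - 1)`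
  (the non-identity Selmer elements restricting to `0`, `Z_v = selmerResKer 5 ℚ_v`) and
  `N_tot(X) = Σ_{E ∈ G, H(E) < X} (#Sel₅(E) - 1)` (all non-identity Selmer elements), for every
  `η > 0` eventually `|m·N₀(X) - N_tot(X)| ≤ η·N_tot(X)` — i.e. `N₀/N_tot → 1/m` whenever `N_tot → ∞`,
  and vacuous (as print is) otherwise; WEAKER than or equal to the printed limit statement. The
  identity classes correspond under the identification (Prop. 11 (i) with `P = P′ = O`; "the
  identification … given by the sets `Ω_i` is the same as the identification in Proposition 11",
  `p0011` L81–L83), so "restricts to the identity class" needs no identification datum: it is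
  `res_v(s) = 0`, i.e. `s ∈ Z_v(E)`.
* NOT typed (weakenings, all disclosed): Thm. 7 (i) / Prop. 11 (ii) (the identification of the images
  of `E(ℚ_ν)[5]`), the other `k - 1` classes, the place `∞`, Remark 10 (several places at once).
* CLOPEN FAMILIES: the tree's `CongruenceFamily` (a modulus and a residue set at each prime) is the
  clopen special case of the source's closed `Σ_ℓ` — a restriction of the hypothesis class, as in every
  sibling typing (`BSDRankZeroDensity.lean`, `RootNumberTwistSubfamily.lean`).

## Scope caveat found in this read (for the sprint's AS-PRINTED audit; the word is the desk's)

The STATEMENTS Thm. 7, Thm. 9, Prop. 11, Prop. 12 carry no reduction-type hypothesis at `ν` (pub-bsdpct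
`AUDIT.md` Input 11: "Prop 12 indeed has no reduction-type hypothesis"), and the fact below types them
as stated. The printed PROOF of Prop. 11 (the local constancy behind (a) and behind Thm. 7 (i)) treats
minimal equations WITHOUT split multiplicative reduction and says (`p0010` L56–L60): "If `E` (and hence
`E′`) has split multiplicative reduction, then a similar identification for which (i) also holds can be
deduced from the Tate uniformization of `E(ℚ_ℓ)` and `E′(ℚ_ℓ)`. As this case is not needed in this
paper, we omit the details." The sprint's slice `SP′` (multiplicative reduction at `5` outside
`S₁′(5) ∪ T₅`) contains curves with split multiplicative reduction at `5`; for those the printed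
argument is the quoted one-sentence sketch. Nothing in this file depends on the distinction.

## The PROVED road from the fact to `hlocP` (this file, § Consequences; = the proof of Lemma 16)

* `resPair`, the `ℓ`-adic residue pair modulo `ℓ ^ k` of a point of `ℤ_ℓ²`; the discs
  `{resPair k · = c}` are open and closed (`PadicInt.ker_toZModPow`, ultrametric balls); its
  dictionary lemmas `resPair_intCast` (an integer point `(A, B)` has residue pair `(A, B) mod ℓ^k` —
  `ν`-adic discs ↔ congruence conditions), `castHom_resPair` (compatibility under
  `ℤ/ℓ^{k'} → ℤ/ℓ^k`, the shrinking `W ⊂ W′` of the proof of Prop. 12) and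
  `residue_eq_of_mem_discFamily` (a member of `F(W)` lies in the class of `(a₀, b₀)` — the support
  hypothesis of the fact / of `EquidistributedOnClass`). (ERRATUM E-G123-5, docstring-only: these
  three public lemmas were missing from this list.)
* `exists_level_forall_of_forall_exists_level`, `forall_residue_of_forall_point` — COMPACTNESS
  ("the large family `F` can be partitioned into a finite union of large subfamilies", proof of
  Lemma 16): if every `ℓ`-adic point with `Δ ≠ 0` has a good disc about it (good = a property of residue
  classes inherited by sub-classes), then every residue class `(a, b) mod ℓ^{k₀}` with
  `ℓ^{k₀} ∤ 4a³ + 27b²` (a compact subset of `ℤ_ℓ² ∖ {Δ = 0}`: `ord_ℓ Δ < k₀` on it) splits at some level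
  `K ≥ k₀` into classes modulo `ℓ ^ K` that are ALL good (`ℤ_ℓ` is compact, `PadicInt.compactSpace`).
* `discFamily ℓ k a₀ b₀` = Prop. 12's `F(W)` for the disc `W = (a₀, b₀) + ℓ^k ℤ_ℓ²` as a
  `CongruenceFamily`; `mem_discFamily_iff`; **`isLarge_discFamily`**: `F(W)` is large when `ℓ` is odd and
  `ℓ ∤ a₀` (Chinese remainder construction as in `CongruenceFamily.isLarge_allCurves`; the case of the
  source's use, inside `S₀(5) = {5 ∤ A}`).
* `EquidistributedOnClass v k c` = the matrix of the fact at one residue class; `.mono` (descends to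
  sub-classes); `thm7_selmerResKer_equidistributed.exists_equidistributedOnClass` / `.forall_residue`
  (the fact, point by point / uniformised over a class).
* **`EquidistributedOnClass.sum_card_selmerResKer_sub_one_le`** — on ONE good piece `G` (large,
  supported in a good class at `5`) with `E(ℚ₅)[5] = 0` on it (`htors`; then
  `m = #E(ℚ₅)/5E(ℚ₅) = 5·#E(ℚ₅)[5] = 5` by the tree's `natCard_kummerLocalConditionAt_adicCompletion` and
  `natCard_adicCompletionIntegers_quot_span_prime` — the sentence "`#E(ℚ_p)/pE(ℚ_p) = p·#E(ℚ_p)[p]`" of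
  the proof of Lemma 16, valid for every reduction type) and with the average of `#Sel₅` eventually
  `≤ 6 + η` on `G` (`h13`, the shape of the binder `h13T`; [BS5] Thm. 31 = Thm. 5 of the source — a
  group-(B) input of the sprint, NOT minted here): for every `η > 0`, eventually
  `Σ_{E ∈ G, H(E) < X} (#Z(E) - 1) ≤ (1 + η)·#{E ∈ G : H(E) < X}` — LITERALLY `hlocP` with `P := G.Mem`,
  `Z AB := (shortWeierstrass AB).selmerResKer 5 ℚ_v` (the count "`= N(X) + ε̃₁(X)`" in `η`-form).
* `eventually_sum_filter_iUnion_le` (sums over finitely many disjoint pieces) and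
  **`thm7_selmerResKer_equidistributed.sum_card_selmerResKer_sub_one_le_discFamily`** — `hlocP` on a
  whole `5`-adic CELL `P = F((a, b) + 5^{k₀}ℤ₅²)` with `5^{k₀} ∤ 4a³ + 27b²` and `5 ∤ a`, from the fact +
  `htors` on the cell + `h13` on its large congruence subfamilies; and
  **`thm7_selmerResKer_equidistributed.sum_card_selmerResKer_sub_one_le_residues`** — `hlocP` on a
  `5`-adic CONDITION SET `P = {(A, B) mod 5^m ∈ R}` (`R` a finite set of residue pairs, every class with
  `5 ∤ a` and `5^m ∤ 4a³ + 27b²`; the currency of `hasHeightDensity_residues` in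
  `LeadingTermBSZLocalDensityProofs.lean`) — the shape of the sprint's `P = SP′_K` (conditions modulo a
  power of `5`, `ord₅ Δ ≤ K`, inside `S₀(5)`), which pub-bsdpct's C0 instantiates.

## Status paragraph (registry wording; the tier word is the desks', the row is lit's pen)

Source = a PUBLISHED paper (J. Ramanujan Math. Soc. 29 (2014); read in the arXiv text whose numbering
the bib note certifies) ⇒ proposed sub-label «literal» for the fact; its own input [BS5]
(arXiv:1312.7859, the `5`-Selmer count) is an unpublished preprint on which Thm. 9's proof rests ("so
[BS5] again applies", `p0009` L103) — the desks may want «literal» qualified accordingly (cf. K1's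
treatment of `h13T`). By-name consumer: the binder `hlocP` of `bsz_rankLeOne_cRank_of_pieces` via the
theorems above, once pub-bsdpct's C0 writes `P = SP′_K` as a `5`-adic condition set
`{(A, B) mod 5^m ∈ R}` (every class with `5 ∤ a`, `5^m ∤ 4a³ + 27b²`) with `Z AB := selmerResKer 5 ℚ_v`,
`htors` from `SelmerBoundLocalTorsionTransportProofs.lean` / the summit-side `localTorsion_eq_zero_of_mult`
(q8), and `h13` from its group-(B) input (`….sum_card_selmerResKer_sub_one_le_residues`; or, in the
exact shape of the tree's `h31` hypothesis of `averageRankLE_of_five_selmer_of_inputs` — the source's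
Theorem 5 = [BS5] Thm 31 for every large family —, `….sum_card_selmerResKer_sub_one_le_residues_of_avg`).
Referee page-reads of the locators above are asked by name at landing.

## Dedup (`lean search`, registry `CITED-FACTS.md`, 2026-08-24)

`lean search 'BhargavaSkinner2014'`: the key is cited by `SelmerLocalRestrictionKernel.lean`,
`LocalPointsPlaceTransportProofs.lean`, `SelmerBoundLocalTorsionTransportProofs.lean`,
`LeadingTermBSZResCellAssemblyProofs.lean`, `HeightDensityFullBSDOffSAprimePieces.lean` — theorems and
one definition with a body (`selmerResKer`), NO `def … : Prop` typing Thm. 7 / Thm. 9 / Prop. 12; the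
only tree occurrence of the equidistribution statement is the ANONYMOUS binder `hlocP` (and `hloc` of
`resCell_count`). `lean search 'equidistrib'` in `Literature/NumberTheory/EllipticCurves`: root-number
equidistribution only (Smith, BSZ Thm. 16 = A328, ternary cubic forms). Registry §A: no row for
Bhargava–Skinner 2014. This is the first typing; proposed registry row A329.

## References

* [BhargavaSkinner2014] M. Bhargava, C. Skinner, J. Ramanujan Math. Soc. 29 (2014) 221–242
  = arXiv:1401.0233: Thm. 7 (`p0005` L18–L40), §4.1 (large families, `p0008` L13–L43), Thm. 9
  (`p0009` L59–L93, proof L95–L106), Remark 10, Prop. 11 (`p0010` L1–L101, esp. L56–L60), Prop. 12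
  (`p0010` L103–L109, proof `p0010` L111 – `p0011` L57), end of the proof of Thm. 7 (`p0011` L59–L89), Lemma 15
  (`p0012` L55–L58), Lemma 16 and its proof (`p0012` L106–L130).
* [BhargavaShankar5Selmer2013] M. Bhargava, A. Shankar, arXiv:1312.7859 (2013), Thm. 31 (the
  `5`-Selmer average in large families; the source's Thm. 5 and the input of Thm. 9's proof).
* [MilneADT2006] J. S. Milne, *Arithmetic Duality Theorems*, 2nd ed., I Lemma 3.3 (the order of
  `E(K_v)/nE(K_v)`; tree `natCard_kummerLocalConditionAt_adicCompletion`).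
-/

noncomputable section

open scoped Classical

open Filter WeierstrassCurve NumberField IsDedekindDomain

namespace Literature.NumberTheory.EllipticCurves.BhargavaSkinner2014

/-! ## The `ℓ`-adic residue pair of a point of `ℤ_ℓ²` and of an integer pair -/

section Residues

variable {ℓ : ℕ} [Fact ℓ.Prime]

/-- The residue of a point `y = (a, b) ∈ ℤ_ℓ²` modulo `ℓ ^ k` (Mathlib's `PadicInt.toZModPow` on both
coordinates): `y` and `y'` have the same residue modulo `ℓ ^ k` iff `y' ∈ y + ℓ^k ℤ_ℓ²`, the
`ℓ`-adic disc of radius `ℓ^{-k}` about `y` — the "`ν`-adic neighborhoods `W`" of the source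
(Prop. 12) are unions of such discs. [cite: BhargavaSkinner2014, Prop 12 (ν-adic neighbourhoods W ⊂ ℤ_ν²)] -/
def resPair (k : ℕ) (y : ℤ_[ℓ] × ℤ_[ℓ]) : ZMod (ℓ ^ k) × ZMod (ℓ ^ k) :=
  (PadicInt.toZModPow k y.1, PadicInt.toZModPow k y.2)

/-- The residue pair of an integer point `(A, B) ∈ ℤ² ⊂ ℤ_ℓ²` is the pair of residues of `A`, `B`
modulo `ℓ ^ k` — the dictionary between the `ν`-adic discs of Prop. 12 and congruence conditions on
`(A, B)` modulo `ℓ ^ k`. [cite: BhargavaSkinner2014, Prop 12 (ν-adic neighbourhoods W ⊂ ℤ_ν²)] -/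
@[simp] theorem resPair_intCast (k : ℕ) (AB : ℤ × ℤ) :
    resPair k (((AB.1 : ℤ_[ℓ]), (AB.2 : ℤ_[ℓ])) : ℤ_[ℓ] × ℤ_[ℓ]) =
      (((AB.1 : ℤ) : ZMod (ℓ ^ k)), ((AB.2 : ℤ) : ZMod (ℓ ^ k))) := by
  simp [resPair]

/-- Compatibility of residue pairs under reduction `ℤ/ℓ^k' → ℤ/ℓ^k` (`k ≤ k'`)
(`PadicInt.cast_toZModPow`): the disc of level `k'` about `y` lies in the disc of level `k` — the
shrinking "`W ⊂ W′`" of the proof of Prop. 12. [cite: BhargavaSkinner2014, Prop 12 (proof: W ⊂ W′)] -/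
theorem castHom_resPair {k k' : ℕ} (h : k ≤ k') (y : ℤ_[ℓ] × ℤ_[ℓ]) :
    (ZMod.castHom (pow_dvd_pow ℓ h) (ZMod (ℓ ^ k)) (resPair k' y).1,
      ZMod.castHom (pow_dvd_pow ℓ h) (ZMod (ℓ ^ k)) (resPair k' y).2) = resPair k y := by
  simp only [resPair, ZMod.castHom_apply, PadicInt.cast_toZModPow _ _ h]

/-- Two `ℓ`-adic integers have the same residue modulo `ℓ ^ k` iff they are `ℓ^{-k}`-close
(`PadicInt.ker_toZModPow`, `PadicInt.norm_le_pow_iff_mem_span_pow`). [folklore] -/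
private theorem toZModPow_eq_iff_norm_sub_le (k : ℕ) (a b : ℤ_[ℓ]) :
    PadicInt.toZModPow k a = PadicInt.toZModPow k b ↔ ‖a - b‖ ≤ (ℓ : ℝ) ^ (-(k : ℤ)) := by
  rw [← RingHom.sub_mem_ker_iff, PadicInt.ker_toZModPow, PadicInt.norm_le_pow_iff_mem_span_pow]

/-- The `ℓ`-adic disc `{y' : resPair k y' = resPair k y}` about `y` is open in `ℤ_ℓ²` (a product of
two closed balls of positive radius in an ultrametric space). [folklore] -/
private theorem isOpen_setOf_resPair_eq (k : ℕ) (y : ℤ_[ℓ] × ℤ_[ℓ]) :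
    IsOpen {y' : ℤ_[ℓ] × ℤ_[ℓ] | resPair k y' = resPair k y} := by
  have hr : ((ℓ : ℝ) ^ (-(k : ℤ))) ≠ 0 :=
    zpow_ne_zero _ (Nat.cast_ne_zero.mpr (Fact.out : ℓ.Prime).ne_zero)
  have h : {y' : ℤ_[ℓ] × ℤ_[ℓ] | resPair k y' = resPair k y} =
      (Metric.closedBall y.1 ((ℓ : ℝ) ^ (-(k : ℤ)))) ×ˢ
        (Metric.closedBall y.2 ((ℓ : ℝ) ^ (-(k : ℤ)))) := by
    ext y'
    simp only [resPair, Set.mem_setOf_eq, Prod.mk.injEq, Set.mem_prod, Metric.mem_closedBall,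
      dist_eq_norm, toZModPow_eq_iff_norm_sub_le]
  rw [h]
  exact (IsUltrametricDist.isOpen_closedBall _ hr).prod (IsUltrametricDist.isOpen_closedBall _ hr)

/-- The residue class `{y : resPair k y = c}` is closed in `ℤ_ℓ²` (its complement is a union of open
discs). [folklore] -/
private theorem isClosed_setOf_resPair_eq (k : ℕ) (c : ZMod (ℓ ^ k) × ZMod (ℓ ^ k)) :
    IsClosed {y : ℤ_[ℓ] × ℤ_[ℓ] | resPair k y = c} := by
  rw [← isOpen_compl_iff, isOpen_iff_forall_mem_open]
  intro y hy
  refine ⟨{y' | resPair k y' = resPair k y}, ?_, isOpen_setOf_resPair_eq k y, rfl⟩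
  intro y' hy' h'
  exact hy (show resPair k y = c by rw [← show resPair k y' = resPair k y from hy']; exact h')

/-- **Uniformisation over a compact set** (the compactness step of the proof of Lemma 16 of the
source: "By Theorem 7, the large family `F` can be partitioned into a finite union of large
subfamilies for each of which …"): if a property `Good k c` of residue classes `c` modulo `ℓ ^ k`
descends to sub-classes (`hmono`) and every point `y` of a compact set `S ⊆ ℤ_ℓ²` has SOME level `k`
at which its class is good, then there is ONE level `K` at which the class of every point of `S` is
good (finite subcover of `S` by the open discs `{resPair k_y · = resPair k_y y}`, `K` = the largest
of the finitely many levels). [cite: BhargavaSkinner2014, proof of Lemma 16 (partition into finitely many subfamilies)] -/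
theorem exists_level_forall_of_forall_exists_level
    (Good : (k : ℕ) → ZMod (ℓ ^ k) × ZMod (ℓ ^ k) → Prop)
    (hmono : ∀ (k k' : ℕ) (h : k ≤ k') (c' : ZMod (ℓ ^ k') × ZMod (ℓ ^ k')),
      Good k (ZMod.castHom (pow_dvd_pow ℓ h) (ZMod (ℓ ^ k)) c'.1,
          ZMod.castHom (pow_dvd_pow ℓ h) (ZMod (ℓ ^ k)) c'.2) → Good k' c')
    {S : Set (ℤ_[ℓ] × ℤ_[ℓ])} (hS : IsCompact S)
    (hgood : ∀ y ∈ S, ∃ k, Good k (resPair k y)) :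
    ∃ K : ℕ, ∀ y ∈ S, Good K (resPair K y) := by
  choose! kf hkf using hgood
  let U : ℤ_[ℓ] × ℤ_[ℓ] → Set (ℤ_[ℓ] × ℤ_[ℓ]) := fun y ↦ {y' | resPair (kf y) y' = resPair (kf y) y}
  obtain ⟨t, htS, hcover⟩ := hS.elim_nhds_subcover U
    (fun y _ ↦ (isOpen_setOf_resPair_eq (kf y) y).mem_nhds rfl)
  refine ⟨t.sup kf, fun y hy ↦ ?_⟩
  obtain ⟨z, hzt, hyz⟩ := Set.mem_iUnion₂.mp (hcover hy)
  have hle : kf z ≤ t.sup kf := Finset.le_sup hzt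
  refine hmono (kf z) (t.sup kf) hle (resPair (t.sup kf) y) ?_
  rw [castHom_resPair hle y, show resPair (kf z) y = resPair (kf z) z from hyz]
  exact hkf z (htS z hzt)

/-- **Refinement form** of the uniformisation: if every `ℓ`-adic point `y` with
`4y₁³ + 27y₂² ≠ 0` has some level at which its residue class is good (with `Good` descending to
sub-classes), then every residue class `c₀` modulo `ℓ ^ k₀` on which `ℓ^{k₀} ∤ 4a³ + 27b²` (so that
`Δ ≠ 0` at every `ℓ`-adic point of the class, which is then a compact subset of `ℤ_ℓ² ∖ {Δ = 0}`)
splits, at some level `K ≥ k₀`, into classes modulo `ℓ ^ K` that are ALL good. This is the shape in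
which a family whose `ℓ`-adic conditions are imposed modulo `ℓ ^ k₀` and stay away from `Δ = 0` is
"partitioned into a finite union of large subfamilies" in the proof of Lemma 16 of the source.
[cite: BhargavaSkinner2014, proof of Lemma 16 (partition into finitely many subfamilies) with Prop 12] -/
theorem forall_residue_of_forall_point
    (Good : (k : ℕ) → ZMod (ℓ ^ k) × ZMod (ℓ ^ k) → Prop)
    (hmono : ∀ (k k' : ℕ) (h : k ≤ k') (c' : ZMod (ℓ ^ k') × ZMod (ℓ ^ k')),
      Good k (ZMod.castHom (pow_dvd_pow ℓ h) (ZMod (ℓ ^ k)) c'.1,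
          ZMod.castHom (pow_dvd_pow ℓ h) (ZMod (ℓ ^ k)) c'.2) → Good k' c')
    (hgood : ∀ y : ℤ_[ℓ] × ℤ_[ℓ], 4 * y.1 ^ 3 + 27 * y.2 ^ 2 ≠ 0 → ∃ k, Good k (resPair k y))
    {k₀ : ℕ} {a b : ℤ} (hΔ : ¬ ((ℓ : ℤ) ^ k₀ ∣ 4 * a ^ 3 + 27 * b ^ 2)) :
    ∃ (K : ℕ) (hK : k₀ ≤ K), ∀ c : ZMod (ℓ ^ K) × ZMod (ℓ ^ K),
      (ZMod.castHom (pow_dvd_pow ℓ hK) (ZMod (ℓ ^ k₀)) c.1 = (a : ZMod (ℓ ^ k₀)) ∧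
        ZMod.castHom (pow_dvd_pow ℓ hK) (ZMod (ℓ ^ k₀)) c.2 = (b : ZMod (ℓ ^ k₀))) →
      Good K c := by
  -- the residue class of `(a, b)` modulo `ℓ ^ k₀`, a compact subset of `ℤ_ℓ²` avoiding `Δ = 0`
  set c₀ : ZMod (ℓ ^ k₀) × ZMod (ℓ ^ k₀) := ((a : ZMod (ℓ ^ k₀)), (b : ZMod (ℓ ^ k₀))) with hc₀
  let S : Set (ℤ_[ℓ] × ℤ_[ℓ]) := {y | resPair k₀ y = c₀}
  have hS : IsCompact S := (isClosed_setOf_resPair_eq k₀ c₀).isCompact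
  have hΔS : ∀ y ∈ S, 4 * y.1 ^ 3 + 27 * y.2 ^ 2 ≠ 0 := by
    intro y hy hzero
    apply hΔ
    have h1 : PadicInt.toZModPow k₀ y.1 = (a : ZMod (ℓ ^ k₀)) := congrArg Prod.fst hy
    have h2 : PadicInt.toZModPow k₀ y.2 = (b : ZMod (ℓ ^ k₀)) := congrArg Prod.snd hy
    have h3 : PadicInt.toZModPow k₀ (4 * y.1 ^ 3 + 27 * y.2 ^ 2) =
        4 * (a : ZMod (ℓ ^ k₀)) ^ 3 + 27 * (b : ZMod (ℓ ^ k₀)) ^ 2 := by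
      simp only [map_add, map_mul, map_pow, map_ofNat, h1, h2]
    rw [hzero, map_zero] at h3
    have h4 : ((4 * a ^ 3 + 27 * b ^ 2 : ℤ) : ZMod (ℓ ^ k₀)) = 0 := by
      push_cast
      exact h3.symm
    rw [ZMod.intCast_zmod_eq_zero_iff_dvd] at h4
    exact_mod_cast h4
  obtain ⟨K, hK⟩ := exists_level_forall_of_forall_exists_level Good hmono hS
    (fun y hy ↦ hgood y (hΔS y hy))
  -- raise the level to `max k₀ K`
  refine ⟨max k₀ K, le_max_left _ _, fun c hc ↦ ?_⟩
  -- a point of the class `c`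
  let y : ℤ_[ℓ] × ℤ_[ℓ] := (((c.1.val : ℕ) : ℤ_[ℓ]), ((c.2.val : ℕ) : ℤ_[ℓ]))
  have hyc : resPair (max k₀ K) y = c := by
    simp only [y, resPair, map_natCast, ZMod.natCast_zmod_val]
  have hyS : y ∈ S := by
    change resPair k₀ y = c₀
    rw [← castHom_resPair (le_max_left k₀ K) y, hyc, hc₀]
    exact Prod.ext hc.1 hc.2
  have hKy : Good K (resPair K y) := hK y hyS
  have hle : K ≤ max k₀ K := le_max_right _ _
  rw [← hyc]
  refine hmono K (max k₀ K) hle (resPair (max k₀ K) y) ?_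
  rw [castHom_resPair hle y]
  exact hKy

end Residues

/-! ## The families `F(W)` of Prop. 12 for an `ℓ`-adic disc `W`: all curves `E_{A,B}` with
`(A, B) ≡ (a₀, b₀) (mod ℓ^k)` -/

section DiscFamily

/-- **The family `F(W)` of Prop. 12 of the source for the `ℓ`-adic disc
`W = (a₀, b₀) + ℓ^k ℤ_ℓ²`**: "the corresponding (large) family `F = F(W)`, consisting of all elliptic
curves `E_{A,B}` with `(A, B) ∈ W`" — as a `CongruenceFamily` (`BSDRankZeroDensity.lean`): level `ℓ ^ k`
at every prime (a harmless uniform choice of the modulus), the single residue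
`(a₀, b₀) (mod ℓ^k)` allowed at `ℓ`, every residue allowed at the primes `p ≠ ℓ`, both signs of the
discriminant allowed. [cite: BhargavaSkinner2014, Prop 12 (the family F(W))] -/
def discFamily (ℓ k : ℕ) (a₀ b₀ : ℤ) : CongruenceFamily where
  expt _ := k
  residues p := if p = ℓ then {(((a₀ : ℤ) : ZMod (p ^ k)), ((b₀ : ℤ) : ZMod (p ^ k)))} else Set.univ
  allowPos := True
  allowNeg := True

/-- Membership in `F(W)`, `W = (a₀, b₀) + ℓ^k ℤ_ℓ²` (`ℓ` prime): `E_{A,B}` is in the height family and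
`(A, B) ≡ (a₀, b₀) (mod ℓ^k)`. [cite: BhargavaSkinner2014, Prop 12 (the family F(W))] -/
theorem mem_discFamily_iff {ℓ : ℕ} (hℓ : ℓ.Prime) (k : ℕ) (a₀ b₀ : ℤ) (AB : ℤ × ℤ) :
    (discFamily ℓ k a₀ b₀).Mem AB ↔
      IsInHeightFamily AB ∧ AB.1 ≡ a₀ [ZMOD (ℓ : ℤ) ^ k] ∧ AB.2 ≡ b₀ [ZMOD (ℓ : ℤ) ^ k] := by
  change (IsInHeightFamily AB ∧
      (∀ p : ℕ, p.Prime →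
        (((AB.1 : ℤ) : ZMod (p ^ k)), ((AB.2 : ℤ) : ZMod (p ^ k))) ∈
          (if p = ℓ then ({(((a₀ : ℤ) : ZMod (p ^ k)), ((b₀ : ℤ) : ZMod (p ^ k)))} :
            Set (ZMod (p ^ k) × ZMod (p ^ k))) else Set.univ)) ∧
      (0 < -(4 * AB.1 ^ 3 + 27 * AB.2 ^ 2) → True) ∧
      (-(4 * AB.1 ^ 3 + 27 * AB.2 ^ 2) < 0 → True)) ↔ _
  constructor
  · rintro ⟨hH, hres, -, -⟩
    have h := hres ℓ hℓ
    rw [if_pos rfl, Set.mem_singleton_iff, Prod.mk.injEq, ZMod.intCast_eq_intCast_iff,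
      ZMod.intCast_eq_intCast_iff] at h
    exact ⟨hH, by exact_mod_cast h.1, by exact_mod_cast h.2⟩
  · rintro ⟨hH, h1, h2⟩
    refine ⟨hH, fun p hp ↦ ?_, fun _ ↦ trivial, fun _ ↦ trivial⟩
    by_cases hpl : p = ℓ
    · subst hpl
      rw [if_pos rfl, Set.mem_singleton_iff, Prod.mk.injEq, ZMod.intCast_eq_intCast_iff,
        ZMod.intCast_eq_intCast_iff]
      exact ⟨by exact_mod_cast h1, by exact_mod_cast h2⟩
    · rw [if_neg hpl]
      exact Set.mem_univ _

/-- A member of `F(W)`, `W = (a₀, b₀) + ℓ^k ℤ_ℓ²`, has residue pair `(a₀, b₀) (mod ℓ^k)` — `F(W)` is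
supported in the class of `(a₀, b₀)`, the hypothesis `_hW` of the fact / of `EquidistributedOnClass`.
[cite: BhargavaSkinner2014, Prop 12 (the family F(W))] -/
theorem residue_eq_of_mem_discFamily {ℓ : ℕ} (hℓ : ℓ.Prime) {k : ℕ} {a₀ b₀ : ℤ} {AB : ℤ × ℤ}
    (h : (discFamily ℓ k a₀ b₀).Mem AB) :
    (((AB.1 : ℤ) : ZMod (ℓ ^ k)), ((AB.2 : ℤ) : ZMod (ℓ ^ k))) =
      (((a₀ : ℤ) : ZMod (ℓ ^ k)), ((b₀ : ℤ) : ZMod (ℓ ^ k))) := by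
  obtain ⟨-, h1, h2⟩ := (mem_discFamily_iff hℓ k a₀ b₀ AB).mp h
  rw [Prod.mk.injEq, ZMod.intCast_eq_intCast_iff, ZMod.intCast_eq_intCast_iff]
  exact ⟨by exact_mod_cast h1, by exact_mod_cast h2⟩

/-- **`F(W)` is large** for `W = (a₀, b₀) + ℓ^k ℤ_ℓ²` with `ℓ` an odd prime and `ℓ ∤ a₀` (the print
"(large)" of Prop. 12, proved in the case needed for the slices of `S₀(ℓ) = {ℓ ∤ A}`): for every prime
`p > ℓ`, every `(a, b)` with `p² ∤ 4a³ + 27b²` and every `j` there is a member `(A, B)` with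
`(A, B) ≡ (a, b) (mod p^j)`. Construction by the Chinese remainder theorem, as for
`CongruenceFamily.isLarge_allCurves`: if `p ∤ a`, take `A ≡ a (mod p^{j+1})`, `A ≡ a₀ (mod ℓ^{k+1})`
and `B ≡ b`, `B ≡ b₀`, `B ≡ 1 (mod 2A)`; if `p ∣ a` (so `p ∤ b`), take `B ≡ b (mod p^{j+1})`,
`B ≡ b₀ (mod ℓ^{k+1})`, `B` odd, and `A ≡ a`, `A ≡ a₀`, `A ≡ 1 (mod B')` with `B'` the prime-to-`ℓ`
part of `|B|`; in both cases `B` is odd and `gcd(A, B) = 1` (`ℓ ∤ A` as `ℓ ∤ a₀`), so `(A, B)` is in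
the height family (`isInHeightFamily_of_odd_of_coprime`). (For a class with `ℓ⁴ ∣ a₀`, `ℓ⁶ ∣ b₀`,
`k ≥ 6` the family is empty; the hypothesis `ℓ ∤ a₀` is the case of the source's use at `ℓ = 5`,
inside `S₀(5) = {5 ∤ A}`.) [cite: BhargavaSkinner2014, Prop 12 ("the corresponding (large) family F(W)")] -/
theorem isLarge_discFamily {ℓ : ℕ} (hℓ : ℓ.Prime) (hℓ2 : ℓ ≠ 2) (k : ℕ) {a₀ : ℤ} (b₀ : ℤ)
    (ha₀ : ¬ (ℓ : ℤ) ∣ a₀) : (discFamily ℓ k a₀ b₀).IsLarge := by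
  refine ⟨ℓ + 1, fun p hpℓ hp a b j hΔ ↦ ?_⟩
  have hpZ : Prime (p : ℤ) := Nat.prime_iff_prime_int.mp hp
  have hℓZ : Prime (ℓ : ℤ) := Nat.prime_iff_prime_int.mp hℓ
  have hpne : p ≠ ℓ := by omega
  have hℓ3 : 3 ≤ ℓ := by have := hℓ.two_le; omega
  have hp3 : 3 ≤ p := by omega
  -- coprimality tools
  have hcopp : ∀ c : ℤ, ¬ (p : ℤ) ∣ c → IsCoprime ((p : ℤ) ^ (j + 1)) c := fun c hc ↦
    (hpZ.irreducible.coprime_iff_not_dvd.mpr hc).pow_left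
  have hcopℓ : ∀ c : ℤ, ¬ (ℓ : ℤ) ∣ c → IsCoprime ((ℓ : ℤ) ^ (k + 1)) c := fun c hc ↦
    (hℓZ.irreducible.coprime_iff_not_dvd.mpr hc).pow_left
  have hp2 : ¬ (p : ℤ) ∣ 2 := fun h ↦ by
    have h' : p ∣ 2 := by exact_mod_cast h
    have := Nat.le_of_dvd two_pos h'
    omega
  have hℓ2' : ¬ (ℓ : ℤ) ∣ 2 := fun h ↦ by
    have h' : ℓ ∣ 2 := by exact_mod_cast h
    have := Nat.le_of_dvd two_pos h'
    omega
  have hpℓcop : IsCoprime ((p : ℤ) ^ (j + 1)) ((ℓ : ℤ) ^ (k + 1)) :=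
    (Nat.isCoprime_iff_coprime.mpr ((Nat.coprime_primes hp hℓ).mpr hpne)).pow
  -- the modulus `M = p^{j+1} ℓ^{k+1}` and the reductions from it
  have hdvdp : (p : ℤ) ^ j ∣ (p : ℤ) ^ (j + 1) * (ℓ : ℤ) ^ (k + 1) :=
    (pow_dvd_pow _ (Nat.le_succ j)).mul_right _
  have hdvdp' : (p : ℤ) ∣ (p : ℤ) ^ (j + 1) * (ℓ : ℤ) ^ (k + 1) :=
    (dvd_pow_self _ (Nat.succ_ne_zero j)).mul_right _
  have hdvdℓ : (ℓ : ℤ) ^ k ∣ (p : ℤ) ^ (j + 1) * (ℓ : ℤ) ^ (k + 1) :=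
    (pow_dvd_pow _ (Nat.le_succ k)).mul_left _
  have hdvdℓ' : (ℓ : ℤ) ∣ (p : ℤ) ^ (j + 1) * (ℓ : ℤ) ^ (k + 1) :=
    (dvd_pow_self _ (Nat.succ_ne_zero k)).mul_left _
  -- a common solution modulo `M` of the two congruences (CRT for the coprime prime powers)
  have hcrt : ∀ u u₀ : ℤ, ∃ w : ℤ, ∀ z : ℤ, z ≡ w [ZMOD (p : ℤ) ^ (j + 1) * (ℓ : ℤ) ^ (k + 1)] →
      z ≡ u [ZMOD (p : ℤ) ^ j] ∧ z ≡ u₀ [ZMOD (ℓ : ℤ) ^ k] ∧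
        ((p : ℤ) ∣ z ↔ (p : ℤ) ∣ u) ∧ ((ℓ : ℤ) ∣ z ↔ (ℓ : ℤ) ∣ u₀) := by
    intro u u₀
    obtain ⟨w, hwu, hwu₀⟩ := exists_modEq_and_modEq hpℓcop u u₀
    refine ⟨w, fun z hz ↦ ⟨?_, ?_, ?_, ?_⟩⟩
    · exact ((hz.of_dvd hdvdp).trans (hwu.of_dvd (pow_dvd_pow _ (Nat.le_succ j))))
    · exact ((hz.of_dvd hdvdℓ).trans (hwu₀.of_dvd (pow_dvd_pow _ (Nat.le_succ k))))
    · have h := (hz.of_dvd hdvdp').trans (hwu.of_dvd (dvd_pow_self _ (Nat.succ_ne_zero j)))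
      exact ⟨fun hd ↦ (Int.ModEq.dvd_iff h).mp hd, fun hd ↦ (Int.ModEq.dvd_iff h).mpr hd⟩
    · have h := (hz.of_dvd hdvdℓ').trans (hwu₀.of_dvd (dvd_pow_self _ (Nat.succ_ne_zero k)))
      exact ⟨fun hd ↦ (Int.ModEq.dvd_iff h).mp hd, fun hd ↦ (Int.ModEq.dvd_iff h).mpr hd⟩
  by_cases hpa : (p : ℤ) ∣ a
  · -- then `p ∤ b`
    have hpb : ¬ (p : ℤ) ∣ b := fun hpb ↦ by
      obtain ⟨a', rfl⟩ := hpa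
      obtain ⟨b', rfl⟩ := hpb
      exact hΔ ⟨4 * p * a' ^ 3 + 27 * b' ^ 2, by ring⟩
    -- `B ≡ b (mod p^{j+1})`, `B ≡ b₀ (mod ℓ^{k+1})`, `B` odd
    obtain ⟨wB, hwB⟩ := hcrt b b₀
    obtain ⟨B, hBw, hB1⟩ := exists_modEq_and_modEq
      (m := (p : ℤ) ^ (j + 1) * (ℓ : ℤ) ^ (k + 1)) (n := 2)
      (((hcopp 2 hp2).mul_left (hcopℓ 2 hℓ2'))) wB 1
    obtain ⟨hBb, hBb₀, hpBiff, -⟩ := hwB B hBw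
    have hBodd : Odd B := by
      obtain ⟨c, hc⟩ := Int.modEq_iff_dvd.mp hB1
      exact ⟨-c, by linarith⟩
    have hB0 : B ≠ 0 := fun h ↦ by simp [h] at hBodd
    have hpB : ¬ (p : ℤ) ∣ B := fun h ↦ hpb (hpBiff.mp h)
    -- the prime-to-`ℓ` part `B'` of `|B|`
    obtain ⟨e, B', hℓB', hBe⟩ := Nat.exists_eq_pow_mul_and_not_dvd (Int.natAbs_ne_zero.mpr hB0) ℓ
      hℓ.one_lt.ne'
    have hB'dvd : (B' : ℤ) ∣ B := by
      rw [← Int.dvd_natAbs, hBe]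
      exact_mod_cast Dvd.intro_left _ rfl
    have hℓB'Z : ¬ (ℓ : ℤ) ∣ (B' : ℤ) := fun h ↦ hℓB' (by exact_mod_cast h)
    have hpB'Z : ¬ (p : ℤ) ∣ (B' : ℤ) := fun h ↦ hpB (h.trans hB'dvd)
    -- `A ≡ a (mod p^{j+1})`, `A ≡ a₀ (mod ℓ^{k+1})`, `A ≡ 1 (mod B')`
    obtain ⟨wA, hwA⟩ := hcrt a a₀
    obtain ⟨A, hAw, hA1⟩ := exists_modEq_and_modEq
      (m := (p : ℤ) ^ (j + 1) * (ℓ : ℤ) ^ (k + 1)) (n := (B' : ℤ))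
      ((hcopp _ hpB'Z).mul_left (hcopℓ _ hℓB'Z)) wA 1
    obtain ⟨hAa, hAa₀, -, hℓAiff⟩ := hwA A hAw
    have hℓA : ¬ (ℓ : ℤ) ∣ A := fun h ↦ ha₀ (hℓAiff.mp h)
    refine ⟨(A, B), (mem_discFamily_iff hℓ k a₀ b₀ _).mpr
      ⟨isInHeightFamily_of_odd_of_coprime hBodd fun q hq hqA hqB ↦ ?_, hAa₀, hBb₀⟩, hAa, hBb⟩
    -- no prime divides both `A` and `B`
    by_cases hqℓ : q = ℓ
    · subst hqℓ
      exact hℓA hqA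
    · -- `q ∣ B`, `q ≠ ℓ` ⟹ `q ∣ B'` ⟹ `q ∤ A` (as `A ≡ 1 (mod B')`)
      have hqB' : (q : ℤ) ∣ (B' : ℤ) := by
        have h1 : q ∣ B.natAbs := by
          have := Int.natAbs_dvd_natAbs.mpr hqB
          simpa using this
        rw [hBe] at h1
        have h2 : q ∣ B' := by
          rcases (Nat.Prime.dvd_mul hq).mp h1 with h | h
          · exact absurd ((Nat.prime_dvd_prime_iff_eq hq hℓ).mp (hq.dvd_of_dvd_pow h)) hqℓ
          · exact h
        exact_mod_cast h2
      exact not_dvd_of_modEq_one hA1 q hq hqB' hqA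
  · -- `p ∤ a`: `A ≡ a (mod p^{j+1})`, `A ≡ a₀ (mod ℓ^{k+1})`, then `B ≡ b`, `B ≡ b₀`, `B ≡ 1 (mod 2A)`
    obtain ⟨wA, hwA⟩ := hcrt a a₀
    obtain ⟨hAa, hAa₀, hpAiff, hℓAiff⟩ := hwA wA (Int.ModEq.refl _)
    set A := wA with hA
    have hpA : ¬ (p : ℤ) ∣ A := fun h ↦ hpa (hpAiff.mp h)
    have hℓA : ¬ (ℓ : ℤ) ∣ A := fun h ↦ ha₀ (hℓAiff.mp h)
    obtain ⟨wB, hwB⟩ := hcrt b b₀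
    obtain ⟨B, hBw, hB1⟩ := exists_modEq_and_modEq
      (m := (p : ℤ) ^ (j + 1) * (ℓ : ℤ) ^ (k + 1)) (n := 2 * A)
      (((hcopp 2 hp2).mul_right (hcopp A hpA)).mul_left
        ((hcopℓ 2 hℓ2').mul_right (hcopℓ A hℓA))) wB 1
    obtain ⟨hBb, hBb₀, -, -⟩ := hwB B hBw
    have hBodd : Odd B := by
      obtain ⟨c, hc⟩ := Int.modEq_iff_dvd.mp hB1
      exact ⟨-(A * c), by linarith⟩
    exact ⟨(A, B), (mem_discFamily_iff hℓ k a₀ b₀ _).mpr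
      ⟨isInHeightFamily_of_odd_of_coprime hBodd fun q hq hqA hqB ↦
        not_dvd_of_modEq_one hB1 q hq (hqA.mul_left 2) hqB, hAa₀, hBb₀⟩, hAa, hBb⟩

end DiscFamily


/-! ## The named fact -/

/-- **Bhargava–Skinner 2014, Theorem 7 (ii) for the identity class at `ν = p = 5` (with Theorem 7 (i)'s
identification, and the disc / constant of Proposition 12 / Theorem 9 (a))**
(J. Ramanujan Math. Soc. 29 (2014) = arXiv:1401.0233; held text `paper:arxiv-1401.0233`). Verbatim:
**Prop. 12** (`p0010` L103–L109) "Fix a place `ν` of `ℚ`. For any given `(A,B) ∈ ℤ_ν² ∖ {Δ = 0}`,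
there exists a `ν`-adic neighborhood `W` of `(A₀,B₀) = (A,B)` in `ℤ_ν²` such that the corresponding
(large) family `F = F(W)`, consisting of all elliptic curves `E_{A,B}` with `(A,B) ∈ W`, satisfies both
(a) and (b) of Theorem 9"; **Thm. 9** (`p0009` L59–L93) "Fix a place `ν` of `ℚ`. Let `F = F_Σ` be a
large family of elliptic curves `E` such that (a) the cardinality of `E(ℚ_ν)/5E(ℚ_ν)` is a constant
`k` for all `E` in `F`; and (b) [the soluble elements of `V(ℤ_ν)` over `Σ_ν` split into `k` open sets
`Ω_i`, `G(ℚ_ν)`-saturated-disjoint, one orbit per invariant pair in each] … When the elliptic curves `E`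
in `F` are ordered by height, the images of the nonidentity `5`-Selmer elements under the restriction
map `Sel₅(E) → E(ℚ_ν)/5E(ℚ_ν) ↔ {Ω₁,…,Ω_k}` are equidistributed" — together the content of **Thm. 7
(ii)** (`p0005` L18–L40, `ν = 5`: "… the images of the non-identity `5`-Selmer elements under the
natural restriction map `Sel₅(E′) → E′(ℚ₅)/5E′(ℚ₅) = E(ℚ₅)/5E(ℚ₅)` are equidistributed in
`E(ℚ₅)/5E(ℚ₅)`"; "To deduce Theorem 7, we combine Theorem 9 with [Props. 11, 12]", `p0009` L113).
Transcription (dictionary in the module docstring): at the source's place `ν = p = 5` ("We set `ν = p = 5`",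
`p0011` L60; `∞` and `ℓ ≠ 5` not transcribed — at `ℓ ≠ 5` the identity-class clause would be a reading of
Thm. 9 + Props. 11–12, not a printed theorem: referee A R211.5 n152), for the place `v ∋ 5` of `ℚ`
(`ℚ_v = v.adicCompletion ℚ`) and every `x ∈ ℤ₅²` with
`4x₁³ + 27x₂² ≠ 0`, there are a level `k` (the disc `W = x + 5^k ℤ₅²`, i.e. the points with
`resPair k · = resPair k x` — equivalent to the printed "a `ν`-adic neighborhood `W`", since the
property below passes to smaller neighbourhoods) and a constant `m` (the printed `k` of (a)) such that
for every LARGE congruence family `G` (`CongruenceFamily.IsLarge`) all of whose members `E_{A,B}` have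
`(A, B) ∈ W` — Thm. 9 applies to such `G` because (a), (b) for `F(W)` restrict to `G` (last sentence
of the proof of Prop. 12, `p0011` L53–L56) —: (a) `#E_{A,B}(ℚ_v)/5E_{A,B}(ℚ_v)`
(`Nat.card (kummerLocalConditionAt 5 ℚ_v)`, the image of the local Kummer map) equals `m` for every
member; and, for every `η > 0`, eventually in the height `X` (`heightFamilyBelow`, `H = max(4|A|³, 27B²)`
as in the source §1): `|m·N₀(X) - N_tot(X)| ≤ η·N_tot(X)`, where
`N₀(X) = Σ_{E ∈ G, H(E) < X} (#Z_v(E) - 1)` counts the non-identity `5`-Selmer elements with trivial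
restriction at `v` (`Z_v(E) = selmerResKer 5 ℚ_v`, the kernel of `res_v` on `Sel₅(E)`) and
`N_tot(X) = Σ_{E ∈ G, H(E) < X} (#Sel₅(E) - 1)` counts all non-identity `5`-Selmer elements — the share
`1/m` of the identity class ("equidistributed", read for ONE of the `m` classes, in count form; weaker
than or equal to print; that the identity of `E(ℚ₅)/5E(ℚ₅)` is the SAME identified class across `W` is
Thm. 7 (i)'s "naturally identified" — Prop. 11's identification is an isomorphism of groups — agreeing with
Thm. 9's (`p0011` L60–L90)). NOT transcribed: Thm. 7 (i) / Prop. 11 (ii) (torsion images), the other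
classes, `ν = ∞`, `ν = ℓ ≠ 5`, Remark 10. SCOPE NOTE: the statements carry no reduction-type hypothesis at `ν`; the
printed proof of Prop. 11 omits the split multiplicative case ("not needed in this paper", `p0010`
L56–L60) — see the module docstring. STATUS: published source ⇒ proposed sub-label «literal» (word =
the desks'); the printed proof (the [BS5] orbit count on `5 ⊗ ∧²5`, Props. 11–12) has no counterpart in
the tree — nothing is asserted, no `_holds` expected. By-name consumer: the binder `hlocP` of
`bsz_rankLeOne_cRank_of_pieces` (`Z AB := selmerResKer 5 ℚ_v`, `P` a union of `5`-adic cells inside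
`S₀(5)`) through `EquidistributedOnClass.sum_card_selmerResKer_sub_one_le` /
`….sum_card_selmerResKer_sub_one_le_discFamily` below, with pub-bsdpct's `h13`-type input and `htors`.
Dedup: no tree `def` types Thm. 7 / 9 / Prop. 12 (the key `BhargavaSkinner2014` tags theorems and the
body-def `selmerResKer` only); first typing.
[cite: BhargavaSkinner2014, Thm 7 (ii) (p0005 L18–L40) for the identity class, with Thm 7 (i) (identification, Prop 11, p0011 L60–L90), Prop 12 (p0010 L103–L109) and Thm 9 (a) (p0009 L59–L93)] -/
def thm7_selmerResKer_equidistributed : Prop :=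
  ∀ [Fact (Nat.Prime 5)] (v : HeightOneSpectrum (𝓞 ℚ)) (_hv : ((5 : ℕ) : 𝓞 ℚ) ∈ v.asIdeal)
    (x : ℤ_[5] × ℤ_[5]) (_hx : 4 * x.1 ^ 3 + 27 * x.2 ^ 2 ≠ 0),
    ∃ (k m : ℕ), ∀ (G : CongruenceFamily) (_hG : G.IsLarge)
      (_hW : ∀ AB, G.Mem AB →
        resPair k (((AB.1 : ℤ_[5]), (AB.2 : ℤ_[5])) : ℤ_[5] × ℤ_[5]) = resPair k x),
      (∀ AB, G.Mem AB →
        Nat.card ((shortWeierstrass AB).kummerLocalConditionAt (5 : ℤ) (v.adicCompletion ℚ)) = m) ∧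
      ∀ η : ℝ, 0 < η → ∀ᶠ X : ℕ in atTop,
        |(m : ℝ) * ∑ AB ∈ (heightFamilyBelow X).filter G.Mem,
              ((Nat.card ((shortWeierstrass AB).selmerResKer (5 : ℤ) (v.adicCompletion ℚ)) : ℝ) - 1) -
            ∑ AB ∈ (heightFamilyBelow X).filter G.Mem,
              ((Nat.card ((shortWeierstrass AB).selmerGroup 5) : ℝ) - 1)| ≤
          η * ∑ AB ∈ (heightFamilyBelow X).filter G.Mem,
              ((Nat.card ((shortWeierstrass AB).selmerGroup 5) : ℝ) - 1)

-- TODO(general form): the places `ν = ∞` and `ν = ℓ ≠ 5` (Thm. 9 / Prop. 12 are stated for any place,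
-- the identity-class identification is printed at `ν = 5` only), the other `k - 1` classes of Thm. 9,
-- Thm. 7 (i) (torsion images, Prop. 11 (ii)) and Remark 10 (several places) are not transcribed; no
-- consumer needs them.

/-! ## Binder shapes (proved, granted the fact) -/

section Consequences

/-- **The matrix of the fact at one residue class** ("the disc `c + ℓ^k ℤ_ℓ²` is one of Prop. 12's
neighbourhoods `W`"): there is a constant `m` such that every large congruence family `G` all of whose
members `(A, B)` reduce to `c` modulo `ℓ ^ k` has (a) `#E_{A,B}(ℚ_ν)/5E_{A,B}(ℚ_ν) = m`
(`Nat.card (kummerLocalConditionAt 5 ℚ_v)`) for every member, and (Thm. 9's conclusion for the identity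
class, count form) for every `η > 0`, eventually in `X`,
`|m·Σ_{E ∈ G, H(E) < X} (#Z_v(E) - 1) - Σ_{E ∈ G, H(E) < X} (#Sel₅(E) - 1)| ≤ η·Σ_{E ∈ G, H(E) < X} (#Sel₅(E) - 1)`
(`Z_v = selmerResKer 5 ℚ_v`). A predicate with arguments, not a named fact.
[cite: BhargavaSkinner2014, Thm 9 ((a) and conclusion) with Prop 12] -/
def EquidistributedOnClass {ℓ : ℕ} (v : HeightOneSpectrum (𝓞 ℚ)) (k : ℕ)
    (c : ZMod (ℓ ^ k) × ZMod (ℓ ^ k)) : Prop :=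
  ∃ m : ℕ, ∀ (G : CongruenceFamily) (_hG : G.IsLarge)
    (_hW : ∀ AB, G.Mem AB → (((AB.1 : ℤ) : ZMod (ℓ ^ k)), ((AB.2 : ℤ) : ZMod (ℓ ^ k))) = c),
    (∀ AB, G.Mem AB →
      Nat.card ((shortWeierstrass AB).kummerLocalConditionAt (5 : ℤ) (v.adicCompletion ℚ)) = m) ∧
    ∀ η : ℝ, 0 < η → ∀ᶠ X : ℕ in atTop,
      |(m : ℝ) * ∑ AB ∈ (heightFamilyBelow X).filter G.Mem,
            ((Nat.card ((shortWeierstrass AB).selmerResKer (5 : ℤ) (v.adicCompletion ℚ)) : ℝ) - 1) -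
          ∑ AB ∈ (heightFamilyBelow X).filter G.Mem,
            ((Nat.card ((shortWeierstrass AB).selmerGroup 5) : ℝ) - 1)| ≤
        η * ∑ AB ∈ (heightFamilyBelow X).filter G.Mem,
            ((Nat.card ((shortWeierstrass AB).selmerGroup 5) : ℝ) - 1)

/-- `EquidistributedOnClass` descends to sub-classes: a family supported in a class modulo `ℓ ^ k'` is
supported in the class modulo `ℓ ^ k` (`k ≤ k'`) below it (the shrinking `W ⊂ W′` of the proof of
Prop. 12). [cite: BhargavaSkinner2014, Prop 12 (proof: W ⊂ W′)] -/
theorem EquidistributedOnClass.mono {ℓ : ℕ} (v : HeightOneSpectrum (𝓞 ℚ)) (k k' : ℕ)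
    (h : k ≤ k') (c' : ZMod (ℓ ^ k') × ZMod (ℓ ^ k'))
    (hc : EquidistributedOnClass v k (ZMod.castHom (pow_dvd_pow ℓ h) (ZMod (ℓ ^ k)) c'.1,
      ZMod.castHom (pow_dvd_pow ℓ h) (ZMod (ℓ ^ k)) c'.2)) :
    EquidistributedOnClass v k' c' := by
  obtain ⟨m, hm⟩ := hc
  refine ⟨m, fun G hG hW ↦ hm G hG fun AB hAB ↦ ?_⟩
  rw [← hW AB hAB]
  simp only [ZMod.castHom_apply, ZMod.cast_intCast (pow_dvd_pow ℓ h)]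

/-- **The fact, point by point**: granted `thm7_selmerResKer_equidistributed`, every `5`-adic point
with `Δ ≠ 0` has a level `k` at which its residue class satisfies `EquidistributedOnClass`.
[cite: BhargavaSkinner2014, Thm 7 (ii) with Prop 12] -/
theorem thm7_selmerResKer_equidistributed.exists_equidistributedOnClass
    (h : thm7_selmerResKer_equidistributed) [Fact (Nat.Prime 5)]
    (v : HeightOneSpectrum (𝓞 ℚ)) (hv : ((5 : ℕ) : 𝓞 ℚ) ∈ v.asIdeal)
    (y : ℤ_[5] × ℤ_[5]) (hy : 4 * y.1 ^ 3 + 27 * y.2 ^ 2 ≠ 0) :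
    ∃ k, EquidistributedOnClass v k (resPair k y) := by
  obtain ⟨k, m, hkm⟩ := h v hv y hy
  refine ⟨k, m, fun G hG hW ↦ hkm G hG fun AB hAB ↦ ?_⟩
  rw [resPair_intCast, hW AB hAB]

/-- **The fact in the currency of congruence conditions** (Thm. 7 (ii) on Prop. 12's discs at `ν = 5`,
uniformised over a residue class by compactness): granted the fact, every residue class
`(a, b) mod 5^{k₀}` with `5^{k₀} ∤ 4a³ + 27b²` splits at some level `K ≥ k₀` into classes modulo
`5 ^ K` that all satisfy `EquidistributedOnClass` — on each of them, every large congruence family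
supported there has constant `#E(ℚ₅)/5E(ℚ₅)` and the identity-class equidistribution of its
non-identity `5`-Selmer elements ("the large family `F` can be partitioned into a finite union of large
subfamilies for each of which the groups `E(ℚ_p)/pE(ℚ_p)` … have been identified", proof of Lemma 16).
[cite: BhargavaSkinner2014, Thm 7 (ii) with Prop 12; proof of Lemma 16 (finite partition)] -/
theorem thm7_selmerResKer_equidistributed.forall_residue
    (h : thm7_selmerResKer_equidistributed) [Fact (Nat.Prime 5)]
    (v : HeightOneSpectrum (𝓞 ℚ)) (hv : ((5 : ℕ) : 𝓞 ℚ) ∈ v.asIdeal)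
    {k₀ : ℕ} {a b : ℤ} (hΔ : ¬ ((5 : ℤ) ^ k₀ ∣ 4 * a ^ 3 + 27 * b ^ 2)) :
    ∃ (K : ℕ) (hK : k₀ ≤ K), ∀ c : ZMod (5 ^ K) × ZMod (5 ^ K),
      (ZMod.castHom (pow_dvd_pow 5 hK) (ZMod (5 ^ k₀)) c.1 = (a : ZMod (5 ^ k₀)) ∧
        ZMod.castHom (pow_dvd_pow 5 hK) (ZMod (5 ^ k₀)) c.2 = (b : ZMod (5 ^ k₀))) →
      EquidistributedOnClass v K c :=
  forall_residue_of_forall_point (EquidistributedOnClass v) (EquidistributedOnClass.mono v)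
    (fun y hy ↦ h.exists_equidistributedOnClass v hv y hy) hΔ

/-- **The binder `hlocP` on one good piece.** Granted the fact, at the place `v ∋ 5`: on a large
congruence family `G` supported in a good class at `5` on which `E_{A,B}(ℚ₅)[5] = 0` (`htors`, so that
`#E(ℚ₅)/5E(ℚ₅) = 5·#E(ℚ₅)[5] = 5`, the sentence "`#E(ℚ_p)/pE(ℚ_p) = p·#E(ℚ_p)[p]`" of the proof of
Lemma 16 — in the tree `natCard_kummerLocalConditionAt_adicCompletion`) and on which the average size of
`Sel₅` is eventually `≤ 6 + η` (`h13`, the shape of the binder `h13T` of `bsz_rankLeOne_cRank_of_pieces`;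
Bhargava–Shankar's Thm. 31 = Thm. 5 of the source), the kernels `Z(E) = Z_v(E)` of the restriction at
`5` satisfy, for every `η > 0`, eventually `Σ_{E ∈ G, H(E) < X} (#Z(E) - 1) ≤ (1 + η)·#{E ∈ G : H(E) < X}`
— LITERALLY the binder `hlocP` of `bsz_rankLeOne_cRank_of_pieces` with `P := G.Mem` and
`Z AB := (shortWeierstrass AB).selmerResKer 5 ℚ_v` (the count "`= N(X) + o(X^{5/6})`" of the proof of
Lemma 16, in the `η`-form). [cite: BhargavaSkinner2014, Thm 7 (ii) and proof of Lemma 16] -/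
theorem EquidistributedOnClass.sum_card_selmerResKer_sub_one_le {v : HeightOneSpectrum (𝓞 ℚ)}
    (hv : ((5 : ℕ) : 𝓞 ℚ) ∈ v.asIdeal) [Fact (Nat.Prime 5)] {k : ℕ} {c : ZMod (5 ^ k) × ZMod (5 ^ k)}
    (hc : EquidistributedOnClass v k c) (G : CongruenceFamily) (hG : G.IsLarge)
    (hW : ∀ AB, G.Mem AB → (((AB.1 : ℤ) : ZMod (5 ^ k)), ((AB.2 : ℤ) : ZMod (5 ^ k))) = c)
    (htors : ∀ AB, G.Mem AB → Nat.card (nsmulAddMonoidHom 5 :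
      ((shortWeierstrass AB).baseChange (v.adicCompletion ℚ)).toAffine.Point →+ _).ker = 1)
    (h13 : ∀ η : ℝ, 0 < η → ∀ᶠ X : ℕ in atTop,
      ∑ AB ∈ (heightFamilyBelow X).filter G.Mem,
          (Nat.card ((shortWeierstrass AB).selmerGroup 5) : ℝ) ≤
        (6 + η) * ((heightFamilyBelow X).filter G.Mem).card) :
    ∀ η : ℝ, 0 < η → ∀ᶠ X : ℕ in atTop,
      ∑ AB ∈ (heightFamilyBelow X).filter G.Mem,
          ((Nat.card ((shortWeierstrass AB).selmerResKer (5 : ℤ) (v.adicCompletion ℚ)) : ℝ) - 1) ≤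
        (1 + η) * ((heightFamilyBelow X).filter G.Mem).card := by
  intro η hη
  obtain ⟨m, hm⟩ := hc
  obtain ⟨ha, hequi⟩ := hm G hG hW
  set δ : ℝ := min η 1 / 3 with hδ
  have hδpos : 0 < δ := by positivity
  have hδη : 7 * δ ≤ 5 * η := by
    have : min η 1 ≤ η := min_le_left _ _
    rw [hδ]; linarith
  have hδ1 : δ ≤ 1 := by
    have : min η 1 ≤ 1 := min_le_right _ _
    rw [hδ]; linarith
  filter_upwards [hequi δ hδpos, h13 δ hδpos] with X hX h13X
  set s := (heightFamilyBelow X).filter G.Mem with hs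
  set N₀ : ℝ := ∑ AB ∈ s,
      ((Nat.card ((shortWeierstrass AB).selmerResKer (5 : ℤ) (v.adicCompletion ℚ)) : ℝ) - 1)
  set Ntot : ℝ := ∑ AB ∈ s, ((Nat.card ((shortWeierstrass AB).selmerGroup 5) : ℝ) - 1) with hNtot
  rcases s.eq_empty_or_nonempty with hempty | ⟨AB, hAB⟩
  · simp [N₀, hempty]
  · -- a member pins the constant: `m = #E(ℚ₅)/5E(ℚ₅) = 5 · #E(ℚ₅)[5] = 5`
    have hmem : G.Mem AB := (Finset.mem_filter.mp hAB).2
    have hm5 : m = 5 := by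
      haveI := isElliptic_shortWeierstrass hmem.1
      have hq := WeierstrassCurve.natCard_adicCompletionIntegers_quot_span_prime (p := 5) hv
      have h𝓛 := (shortWeierstrass AB).natCard_kummerLocalConditionAt_adicCompletion v
        (n := 5) (by norm_num)
      rw [htors AB hmem, one_mul, hq] at h𝓛
      rw [← ha AB hmem]
      exact_mod_cast h𝓛
    -- `Ntot = Σ #Sel₅ - #s ≤ (5 + δ)·#s`
    have hNtot_le : Ntot ≤ (5 + δ) * s.card := by
      have : Ntot = (∑ AB ∈ s, (Nat.card ((shortWeierstrass AB).selmerGroup 5) : ℝ)) - s.card := by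
        rw [hNtot, Finset.sum_sub_distrib]
        simp
      rw [this]; linarith
    have habs := (abs_le.mp hX).2
    rw [hm5] at habs
    push_cast at habs
    have hcard : (0 : ℝ) ≤ s.card := Nat.cast_nonneg _
    -- `5·N₀ ≤ (1 + δ)·Ntot ≤ (1 + δ)(5 + δ)·#s ≤ 5(1 + η)·#s`
    nlinarith [mul_le_mul_of_nonneg_left hNtot_le (by linarith : (0 : ℝ) ≤ 1 + δ),
      mul_nonneg hδpos.le hcard, mul_nonneg (mul_nonneg hδpos.le hδpos.le) hcard]

/-- **Assembling a piece from finitely many sub-pieces** (bookkeeping for the consumer of `hlocP`):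
if a count of the shape `Σ_{E ∈ P_i, H(E) < X} f(E) ≤ c · #{E ∈ P_i : H(E) < X}` holds eventually
for each of finitely many pairwise disjoint predicates `P_i`, it holds eventually for their union
(the summation over "each of these subfamilies" in the proof of Lemma 16).
[cite: BhargavaSkinner2014, proof of Lemma 16 (sum over the finitely many subfamilies)] -/
theorem eventually_sum_filter_iUnion_le {ι : Type*} [Fintype ι] (P : ι → ℤ × ℤ → Prop)
    (hdisj : ∀ i j, i ≠ j → ∀ AB, P i AB → ¬ P j AB) (f : ℤ × ℤ → ℝ) (c : ℝ)
    (h : ∀ i, ∀ᶠ X : ℕ in atTop,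
      ∑ AB ∈ (heightFamilyBelow X).filter (P i), f AB ≤ c * ((heightFamilyBelow X).filter (P i)).card) :
    ∀ᶠ X : ℕ in atTop,
      ∑ AB ∈ (heightFamilyBelow X).filter (fun AB ↦ ∃ i, P i AB), f AB ≤
        c * ((heightFamilyBelow X).filter (fun AB ↦ ∃ i, P i AB)).card := by
  filter_upwards [Filter.eventually_all.mpr h] with X hX
  have hunion : (heightFamilyBelow X).filter (fun AB ↦ ∃ i, P i AB) =
      (Finset.univ : Finset ι).biUnion (fun i ↦ (heightFamilyBelow X).filter (P i)) := by
    ext AB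
    simp only [Finset.mem_filter, Finset.mem_biUnion, Finset.mem_univ, true_and]
    constructor
    · rintro ⟨hAB, i, hi⟩
      exact ⟨i, hAB, hi⟩
    · rintro ⟨i, hAB, hi⟩
      exact ⟨hAB, i, hi⟩
  have hpd : (↑(Finset.univ : Finset ι) : Set ι).PairwiseDisjoint
      (fun i ↦ (heightFamilyBelow X).filter (P i)) := by
    intro i _ j _ hij
    rw [Function.onFun, Finset.disjoint_left]
    intro AB hi hj
    exact hdisj i j hij AB (Finset.mem_filter.mp hi).2 (Finset.mem_filter.mp hj).2
  rw [hunion, Finset.sum_biUnion hpd, Finset.card_biUnion hpd, Nat.cast_sum, Finset.mul_sum]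
  exact Finset.sum_le_sum fun i _ ↦ hX i

/-- **The binder `hlocP` on a whole `5`-adic cell, assembled.** Granted the fact, at the place
`v ∋ 5`: let `(a, b) mod 5^{k₀}` be a residue class with `5^{k₀} ∤ 4a³ + 27b²` (the cell stays away
from `Δ = 0`: `ord₅ Δ < k₀` on it — the truncation `ord₅ Δ ≤ K` of the slice `SP′` in
`bsz_rankLeOne_cRank_of_pieces`) and `5 ∤ a` (the cell lies in `S₀(5) = {5 ∤ A}`), and let
`P = F(W)` be the family of all curves in that class (`discFamily 5 k₀ a b`). If `E(ℚ₅)[5] = 0` on `P`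
(`htors`) and the average of `#Sel₅` is eventually `≤ 6 + η` on every large congruence subfamily of
`P` (`h13`, Bhargava–Shankar's Thm. 31 = Thm. 5 of the source, the shape of the binder `h13T`), then
for every `η > 0`, eventually `Σ_{E ∈ P, H(E) < X} (#Z(E) - 1) ≤ (1 + η)·#{E ∈ P : H(E) < X}` with
`Z(E) = Z_v(E)` the kernel of the restriction at `5` — the binder `hlocP` for the piece `P`. Proof =
the proof of Lemma 16 of the source: the class splits at some level `K` into finitely many good
sub-classes (`forall_residue`: Prop. 12 at every `5`-adic point of the compact cell + compactness),
the sub-families `F(W_c)` are large (`isLarge_discFamily`), on each the count holds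
(`EquidistributedOnClass.sum_card_selmerResKer_sub_one_le`: Thm. 9 + "`#E(ℚ₅)/5E(ℚ₅) = 5·#E(ℚ₅)[5] = 5`"), and the
counts add up over the disjoint sub-classes. [cite: BhargavaSkinner2014, Thm 7 (ii), Thm 9, Prop 12 and proof of Lemma 16] -/
theorem thm7_selmerResKer_equidistributed.sum_card_selmerResKer_sub_one_le_discFamily
    (h : thm7_selmerResKer_equidistributed) [Fact (Nat.Prime 5)]
    {v : HeightOneSpectrum (𝓞 ℚ)} (hv : ((5 : ℕ) : 𝓞 ℚ) ∈ v.asIdeal)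
    {k₀ : ℕ} {a b : ℤ} (hΔ : ¬ ((5 : ℤ) ^ k₀ ∣ 4 * a ^ 3 + 27 * b ^ 2)) (ha : ¬ (5 : ℤ) ∣ a)
    (htors : ∀ AB, (discFamily 5 k₀ a b).Mem AB → Nat.card (nsmulAddMonoidHom 5 :
      ((shortWeierstrass AB).baseChange (v.adicCompletion ℚ)).toAffine.Point →+ _).ker = 1)
    (h13 : ∀ G : CongruenceFamily, G.IsLarge → (∀ AB, G.Mem AB → (discFamily 5 k₀ a b).Mem AB) →
      ∀ η : ℝ, 0 < η → ∀ᶠ X : ℕ in atTop,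
        ∑ AB ∈ (heightFamilyBelow X).filter G.Mem,
            (Nat.card ((shortWeierstrass AB).selmerGroup 5) : ℝ) ≤
          (6 + η) * ((heightFamilyBelow X).filter G.Mem).card) :
    ∀ η : ℝ, 0 < η → ∀ᶠ X : ℕ in atTop,
      ∑ AB ∈ (heightFamilyBelow X).filter (discFamily 5 k₀ a b).Mem,
          ((Nat.card ((shortWeierstrass AB).selmerResKer (5 : ℤ) (v.adicCompletion ℚ)) : ℝ) - 1) ≤
        (1 + η) * ((heightFamilyBelow X).filter (discFamily 5 k₀ a b).Mem).card := by
  intro η hη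
  have h5 : Nat.Prime 5 := Fact.out
  have hk₀ : 1 ≤ k₀ := by
    rcases Nat.eq_zero_or_pos k₀ with rfl | hpos
    · exact absurd (by simp) hΔ
    · exact hpos
  obtain ⟨K, hK, hgood⟩ := h.forall_residue v hv (k₀ := k₀) (a := a) (b := b)
    (by exact_mod_cast hΔ)
  -- the sub-classes modulo `5 ^ K` above `(a, b) mod 5^{k₀}`
  let ι := {c : ZMod (5 ^ K) × ZMod (5 ^ K) //
    ZMod.castHom (pow_dvd_pow 5 hK) (ZMod (5 ^ k₀)) c.1 = (a : ZMod (5 ^ k₀)) ∧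
      ZMod.castHom (pow_dvd_pow 5 hK) (ZMod (5 ^ k₀)) c.2 = (b : ZMod (5 ^ k₀))}
  let P : ι → ℤ × ℤ → Prop := fun c ↦ (discFamily 5 K (c.1.1.val : ℤ) (c.1.2.val : ℤ)).Mem
  -- an integer lifting a residue above `a` reduces to `a` modulo `5^{k₀}`, and similarly for `b`
  have hlift : ∀ (c : ZMod (5 ^ K)) (z : ℤ),
      ZMod.castHom (pow_dvd_pow 5 hK) (ZMod (5 ^ k₀)) c = (z : ZMod (5 ^ k₀)) →
      (c.val : ℤ) ≡ z [ZMOD (5 : ℤ) ^ k₀] := by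
    intro c z hc
    rw [ZMod.castHom_apply, ZMod.cast_eq_val] at hc
    have := (ZMod.intCast_eq_intCast_iff (c.val : ℤ) z (5 ^ k₀)).mp (by exact_mod_cast hc)
    exact_mod_cast this
  -- membership in `P` is membership in exactly one sub-piece
  have hPsub : ∀ (c : ι) AB, P c AB → (discFamily 5 k₀ a b).Mem AB := by
    rintro ⟨c, hc1, hc2⟩ AB hAB
    obtain ⟨hH, h1, h2⟩ := (mem_discFamily_iff h5 K _ _ AB).mp hAB
    refine (mem_discFamily_iff h5 k₀ a b AB).mpr ⟨hH, ?_, ?_⟩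
    · exact (h1.of_dvd (pow_dvd_pow _ hK)).trans (hlift c.1 a hc1)
    · exact (h2.of_dvd (pow_dvd_pow _ hK)).trans (hlift c.2 b hc2)
  have hmem : ∀ AB, (discFamily 5 k₀ a b).Mem AB ↔ ∃ c : ι, P c AB := by
    intro AB
    constructor
    · intro hAB
      obtain ⟨hH, h1, h2⟩ := (mem_discFamily_iff h5 k₀ a b AB).mp hAB
      have hc : ZMod.castHom (pow_dvd_pow 5 hK) (ZMod (5 ^ k₀)) ((AB.1 : ℤ) : ZMod (5 ^ K)) =
            (a : ZMod (5 ^ k₀)) ∧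
          ZMod.castHom (pow_dvd_pow 5 hK) (ZMod (5 ^ k₀)) ((AB.2 : ℤ) : ZMod (5 ^ K)) =
            (b : ZMod (5 ^ k₀)) := by
        rw [map_intCast, map_intCast, ZMod.intCast_eq_intCast_iff, ZMod.intCast_eq_intCast_iff]
        exact ⟨by exact_mod_cast h1, by exact_mod_cast h2⟩
      refine ⟨⟨(((AB.1 : ℤ) : ZMod (5 ^ K)), ((AB.2 : ℤ) : ZMod (5 ^ K))), hc⟩, ?_⟩
      refine (mem_discFamily_iff h5 K _ _ AB).mpr ⟨hH, ?_, ?_⟩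
      · have : ((AB.1 : ℤ) : ZMod (5 ^ K)) = ((((AB.1 : ℤ) : ZMod (5 ^ K)).val : ℤ) : ZMod (5 ^ K)) := by
          rw [Int.cast_natCast, ZMod.natCast_zmod_val]
        have := (ZMod.intCast_eq_intCast_iff _ _ _).mp this
        exact_mod_cast this
      · have : ((AB.2 : ℤ) : ZMod (5 ^ K)) = ((((AB.2 : ℤ) : ZMod (5 ^ K)).val : ℤ) : ZMod (5 ^ K)) := by
          rw [Int.cast_natCast, ZMod.natCast_zmod_val]
        have := (ZMod.intCast_eq_intCast_iff _ _ _).mp this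
        exact_mod_cast this
    · rintro ⟨c, hc⟩
      exact hPsub c AB hc
  -- the residue pair of a member of the sub-piece `c` is `c`
  have hres : ∀ (c : ι) AB, P c AB →
      (((AB.1 : ℤ) : ZMod (5 ^ K)), ((AB.2 : ℤ) : ZMod (5 ^ K))) = c.1 := by
    intro c AB hAB
    have h := residue_eq_of_mem_discFamily h5 hAB
    rw [h, Int.cast_natCast, Int.cast_natCast, ZMod.natCast_zmod_val, ZMod.natCast_zmod_val]
  have hdisj : ∀ i j : ι, i ≠ j → ∀ AB, P i AB → ¬ P j AB := by
    intro i j hij AB hi hj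
    exact hij (Subtype.ext ((hres i AB hi).symm.trans (hres j AB hj)))
  -- each sub-piece is large (`5 ∤` its first residue, as `5 ∤ a` and `k₀ ≥ 1`)
  have hlarge : ∀ c : ι, (discFamily 5 K (c.1.1.val : ℤ) (c.1.2.val : ℤ)).IsLarge := by
    rintro ⟨c, hc1, -⟩
    refine isLarge_discFamily h5 (by norm_num) K _ fun h5c ↦ ha ?_
    have hmod := hlift c.1 a hc1
    have h5k : (5 : ℤ) ∣ (5 : ℤ) ^ k₀ := dvd_pow_self 5 (by omega)
    exact ((hmod.of_dvd h5k).dvd_iff).mp h5c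
  -- the count on each sub-piece
  have hpiece : ∀ c : ι, ∀ᶠ X : ℕ in atTop,
      ∑ AB ∈ (heightFamilyBelow X).filter (P c),
          ((Nat.card ((shortWeierstrass AB).selmerResKer (5 : ℤ) (v.adicCompletion ℚ)) : ℝ) - 1) ≤
        (1 + η) * ((heightFamilyBelow X).filter (P c)).card := fun c ↦
    (hgood c.1 c.2).sum_card_selmerResKer_sub_one_le hv _ (hlarge c) (hres c)
      (fun AB hAB ↦ htors AB (hPsub c AB hAB)) (h13 _ (hlarge c) (hPsub c)) η hη
  -- add up over the disjoint sub-pieces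
  have hfilter : ∀ X : ℕ, (heightFamilyBelow X).filter (discFamily 5 k₀ a b).Mem =
      (heightFamilyBelow X).filter (fun AB ↦ ∃ c : ι, P c AB) := fun X ↦
    Finset.filter_congr fun AB _ ↦ hmem AB
  simp only [hfilter]
  exact eventually_sum_filter_iUnion_le P hdisj _ (1 + η) hpiece

/-- **The binder `hlocP` on a `5`-adic condition set, assembled** — the shape in which the sprint's
slice is written (cf. `hasHeightDensity_residues` in `LeadingTermBSZLocalDensityProofs.lean`): for a
finite set `R` of residue pairs modulo `5 ^ m` all of whose classes lie in `S₀(5) = {5 ∤ A}` (`hRa`) and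
stay away from `Δ = 0` (`hRΔ`: `5^m ∤ 4a³ + 27b²` on every class, i.e. `ord₅ Δ < m` — the truncation
`ord₅ Δ ≤ K` of `SP′_K` with `m = K + 1`), granted the fact, `E(ℚ₅)[5] = 0` on the set (`htors`) and
the `h13`-type average bound on its large congruence subfamilies, the kernels `Z(E) = Z_v(E)` of the
restriction at `5` satisfy, for every `η > 0`, eventually
`Σ_{E ∈ P, H(E) < X} (#Z(E) - 1) ≤ (1 + η)·#{E ∈ P : H(E) < X}` for `P = {(A, B) mod 5^m ∈ R}` —
the binder `hlocP` of `bsz_rankLeOne_cRank_of_pieces` for `P`, `Z AB := selmerResKer 5 ℚ_v`. (The set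
is the disjoint union of the cells `discFamily 5 m a b`, `(a, b) ∈ R`; sum of
`sum_card_selmerResKer_sub_one_le_discFamily` over them.)
[cite: BhargavaSkinner2014, Thm 7 (ii), Thm 9, Prop 12 and proof of Lemma 16] -/
theorem thm7_selmerResKer_equidistributed.sum_card_selmerResKer_sub_one_le_residues
    (h : thm7_selmerResKer_equidistributed) [Fact (Nat.Prime 5)]
    {v : HeightOneSpectrum (𝓞 ℚ)} (hv : ((5 : ℕ) : 𝓞 ℚ) ∈ v.asIdeal) {m : ℕ}
    (R : Finset (ZMod (5 ^ m) × ZMod (5 ^ m)))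
    (hRa : ∀ a b : ℤ, (((a : ℤ) : ZMod (5 ^ m)), ((b : ℤ) : ZMod (5 ^ m))) ∈ R → ¬ (5 : ℤ) ∣ a)
    (hRΔ : ∀ a b : ℤ, (((a : ℤ) : ZMod (5 ^ m)), ((b : ℤ) : ZMod (5 ^ m))) ∈ R →
      ¬ ((5 : ℤ) ^ m ∣ 4 * a ^ 3 + 27 * b ^ 2))
    (htors : ∀ AB, IsInHeightFamily AB →
      (((AB.1 : ℤ) : ZMod (5 ^ m)), ((AB.2 : ℤ) : ZMod (5 ^ m))) ∈ R →
      Nat.card (nsmulAddMonoidHom 5 :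
        ((shortWeierstrass AB).baseChange (v.adicCompletion ℚ)).toAffine.Point →+ _).ker = 1)
    (h13 : ∀ G : CongruenceFamily, G.IsLarge →
      (∀ AB, G.Mem AB → (((AB.1 : ℤ) : ZMod (5 ^ m)), ((AB.2 : ℤ) : ZMod (5 ^ m))) ∈ R) →
      ∀ η : ℝ, 0 < η → ∀ᶠ X : ℕ in atTop,
        ∑ AB ∈ (heightFamilyBelow X).filter G.Mem,
            (Nat.card ((shortWeierstrass AB).selmerGroup 5) : ℝ) ≤
          (6 + η) * ((heightFamilyBelow X).filter G.Mem).card) :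
    ∀ η : ℝ, 0 < η → ∀ᶠ X : ℕ in atTop,
      ∑ AB ∈ (heightFamilyBelow X).filter
          (fun AB ↦ (((AB.1 : ℤ) : ZMod (5 ^ m)), ((AB.2 : ℤ) : ZMod (5 ^ m))) ∈ R),
          ((Nat.card ((shortWeierstrass AB).selmerResKer (5 : ℤ) (v.adicCompletion ℚ)) : ℝ) - 1) ≤
        (1 + η) * ((heightFamilyBelow X).filter
          (fun AB ↦ (((AB.1 : ℤ) : ZMod (5 ^ m)), ((AB.2 : ℤ) : ZMod (5 ^ m))) ∈ R)).card := by
  intro η hη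
  have h5 : Nat.Prime 5 := Fact.out
  -- the cells `discFamily 5 m a b`, `(a, b) ∈ R`
  let ι := {c : ZMod (5 ^ m) × ZMod (5 ^ m) // c ∈ R}
  let P : ι → ℤ × ℤ → Prop := fun c ↦ (discFamily 5 m (c.1.1.val : ℤ) (c.1.2.val : ℤ)).Mem
  have hcast : ∀ c : ZMod (5 ^ m) × ZMod (5 ^ m),
      ((((c.1.val : ℕ) : ℤ) : ZMod (5 ^ m)), (((c.2.val : ℕ) : ℤ) : ZMod (5 ^ m))) = c := by
    intro c
    rw [Int.cast_natCast, Int.cast_natCast, ZMod.natCast_zmod_val, ZMod.natCast_zmod_val]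
  -- residue pair of a member of the cell `c` is `c`
  have hres : ∀ (c : ι) AB, P c AB →
      (((AB.1 : ℤ) : ZMod (5 ^ m)), ((AB.2 : ℤ) : ZMod (5 ^ m))) = c.1 := by
    intro c AB hAB
    rw [residue_eq_of_mem_discFamily h5 hAB, hcast]
  have hdisj : ∀ i j : ι, i ≠ j → ∀ AB, P i AB → ¬ P j AB := by
    intro i j hij AB hi hj
    exact hij (Subtype.ext ((hres i AB hi).symm.trans (hres j AB hj)))
  -- the count on each cell
  have hpiece : ∀ c : ι, ∀ᶠ X : ℕ in atTop,
      ∑ AB ∈ (heightFamilyBelow X).filter (P c),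
          ((Nat.card ((shortWeierstrass AB).selmerResKer (5 : ℤ) (v.adicCompletion ℚ)) : ℝ) - 1) ≤
        (1 + η) * ((heightFamilyBelow X).filter (P c)).card := by
    rintro ⟨c, hcR⟩
    have hcR' : ((((c.1.val : ℕ) : ℤ) : ZMod (5 ^ m)), (((c.2.val : ℕ) : ℤ) : ZMod (5 ^ m))) ∈ R := by
      rw [hcast]; exact hcR
    refine h.sum_card_selmerResKer_sub_one_le_discFamily hv (hRΔ _ _ hcR') (hRa _ _ hcR')
      (fun AB hAB ↦ htors AB hAB.1 ?_) (fun G hG hsub ↦ h13 G hG fun AB hAB ↦ ?_) η hη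
    · rw [hres ⟨c, hcR⟩ AB hAB]; exact hcR
    · rw [hres ⟨c, hcR⟩ AB (hsub AB hAB)]; exact hcR
  -- the set is the disjoint union of the cells (on the height family)
  have hfilter : ∀ X : ℕ, (heightFamilyBelow X).filter
      (fun AB ↦ (((AB.1 : ℤ) : ZMod (5 ^ m)), ((AB.2 : ℤ) : ZMod (5 ^ m))) ∈ R) =
      (heightFamilyBelow X).filter (fun AB ↦ ∃ c : ι, P c AB) := by
    intro X
    refine Finset.filter_congr fun AB hAB ↦ ?_
    have hH : IsInHeightFamily AB := ((mem_heightFamilyBelow_iff AB X).mp hAB).1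
    constructor
    · intro hR
      refine ⟨⟨_, hR⟩, (mem_discFamily_iff h5 m _ _ AB).mpr ⟨hH, ?_, ?_⟩⟩
      · have : ((AB.1 : ℤ) : ZMod (5 ^ m)) = ((((AB.1 : ℤ) : ZMod (5 ^ m)).val : ℤ) : ZMod (5 ^ m)) := by
          rw [Int.cast_natCast, ZMod.natCast_zmod_val]
        have := (ZMod.intCast_eq_intCast_iff _ _ _).mp this
        exact_mod_cast this
      · have : ((AB.2 : ℤ) : ZMod (5 ^ m)) = ((((AB.2 : ℤ) : ZMod (5 ^ m)).val : ℤ) : ZMod (5 ^ m)) := by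
          rw [Int.cast_natCast, ZMod.natCast_zmod_val]
        have := (ZMod.intCast_eq_intCast_iff _ _ _).mp this
        exact_mod_cast this
    · rintro ⟨c, hc⟩
      rw [hres c AB hc]; exact c.2
  simp only [hfilter]
  exact eventually_sum_filter_iUnion_le P hdisj _ (1 + η) hpiece

/-- **`hlocP` on a `5`-adic condition set, with the `5`-Selmer average input in the TREE's shape of
the source's Theorem 5 (= [BS5] Thm 31).** Same statement as
`sum_card_selmerResKer_sub_one_le_residues`, but the average-`#Sel₅` input is taken once, for ALL
large congruence families, in the exact shape of the hypothesis `h31` of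
`averageRankLE_of_five_selmer_of_inputs` (`BSDAverageRankFiveSelmer.lean` — the tree's transcription,
in `limsup ≤ 6` form, of "When elliptic curves `E` over `ℚ` in any large family are ordered by height,
the average order of the `5`-Selmer group `Sel₅(E)` is equal to `6`", the source's Theorem 5 quoting
[BS5] = Bhargava–Shankar, arXiv:1312.7859, Thm 31; NOT a fact of the tree and not vendored here). The
passage from the average form to the sum form on one family is the tree's
`eventually_sum_le_of_heightAverageOn_le` with a single piece. This is the use the printed proof of
Lemma 16 makes of it: "By Theorem 5, Lemma 15, and the equidistribution result of Theorem 7 for the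
curves in each of these subfamilies …".
[cite: BhargavaSkinner2014, Thm 5 (as hypothesis) and proof of Lemma 16] -/
theorem thm7_selmerResKer_equidistributed.sum_card_selmerResKer_sub_one_le_residues_of_avg
    (h : thm7_selmerResKer_equidistributed) [Fact (Nat.Prime 5)]
    {v : HeightOneSpectrum (𝓞 ℚ)} (hv : ((5 : ℕ) : 𝓞 ℚ) ∈ v.asIdeal) {m : ℕ}
    (R : Finset (ZMod (5 ^ m) × ZMod (5 ^ m)))
    (hRa : ∀ a b : ℤ, (((a : ℤ) : ZMod (5 ^ m)), ((b : ℤ) : ZMod (5 ^ m))) ∈ R → ¬ (5 : ℤ) ∣ a)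
    (hRΔ : ∀ a b : ℤ, (((a : ℤ) : ZMod (5 ^ m)), ((b : ℤ) : ZMod (5 ^ m))) ∈ R →
      ¬ ((5 : ℤ) ^ m ∣ 4 * a ^ 3 + 27 * b ^ 2))
    (htors : ∀ AB, IsInHeightFamily AB →
      (((AB.1 : ℤ) : ZMod (5 ^ m)), ((AB.2 : ℤ) : ZMod (5 ^ m))) ∈ R →
      Nat.card (nsmulAddMonoidHom 5 :
        ((shortWeierstrass AB).baseChange (v.adicCompletion ℚ)).toAffine.Point →+ _).ker = 1)
    (h31 : ∀ F : CongruenceFamily, F.IsLarge → ∀ ε : ℝ, 0 < ε → ∀ᶠ X : ℕ in atTop,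
      heightAverageOn F.Mem (fun AB ↦ (Nat.card ((shortWeierstrass AB).selmerGroup 5) : ℝ)) X ≤
        6 + ε) :
    ∀ η : ℝ, 0 < η → ∀ᶠ X : ℕ in atTop,
      ∑ AB ∈ (heightFamilyBelow X).filter
          (fun AB ↦ (((AB.1 : ℤ) : ZMod (5 ^ m)), ((AB.2 : ℤ) : ZMod (5 ^ m))) ∈ R),
          ((Nat.card ((shortWeierstrass AB).selmerResKer (5 : ℤ) (v.adicCompletion ℚ)) : ℝ) - 1) ≤
        (1 + η) * ((heightFamilyBelow X).filter
          (fun AB ↦ (((AB.1 : ℤ) : ZMod (5 ^ m)), ((AB.2 : ℤ) : ZMod (5 ^ m))) ∈ R)).card :=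
  h.sum_card_selmerResKer_sub_one_le_residues hv R hRa hRΔ htors fun G hG _ η hη ↦
    eventually_sum_le_of_heightAverageOn_le (fun _ : Fin 1 ↦ G.Mem)
      (fun i j hij _ _ _ ↦ (hij (Subsingleton.elim i j)).elim) G.Mem
      (fun _ ↦ ⟨fun hAB ↦ ⟨0, hAB⟩, fun ⟨_, hAB⟩ ↦ hAB⟩) _ (fun _ ↦ h31 G hG η hη)

end Consequences

end Literature.NumberTheory.EllipticCurves.BhargavaSkinner2014

end
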